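import Summits.QuantumFields.YangMills.Theorems.LuscherReductionTraceDoorBasics
import Summits.QuantumFields.YangMills.Theorems.LuscherReductionTraceDoorEnclosure
import Summits.QuantumFields.YangMills.Theorems.LuscherReductionTraceDoorKT
import Summits.QuantumFields.YangMills.Theorems.LuscherReductionRunningReductionOneSiteTailClosed
import Summits.QuantumFields.YangMills.Theorems.LuscherReductionRunningReductionOneSiteTailGlue
import Summits.QuantumFields.YangMills.Theorems.LuscherReductionTraceFormulaClosed
import Summits.QuantumFields.YangMills.Theorems.LuscherReductionRunningReductionKTDoorR3
import Summits.QuantumFields.YangMills.Theorems.LuscherReductionRunningReductionKTRCalibration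
import Summits.QuantumFields.YangMills.Theorems.FemtoTransferGapBounds
import Summits.QuantumFields.YangMills.Theorems.LuscherReductionTraceDoorCorollary
import HarnessLib

/-!
# Crux RED `RunningReduction` (stmt-QuantumFields-19978), child ★`TwistedTraceScaling` (stmt-QuantumFields-20203):
# the UPPER-HALF TT DOOR — a ONE-SIDED, vacuum-normalised trace law `UpperTraceLaw` replaces the two-sided dyadic ratio law

Planner ym-cruxidea-19978-1 GEN 7 → GEN 8 rev 3 (crux-ideate seat, levers (b)/(c); refine of this seat's card C `twisted-trace-tauberian`, whose VERBATIM text is the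
route child `TwistedTraceScaling`).  TREE IMPORTS ONLY (Cruxes/Lines modules are not built on the farm).  SORRY-FREE.

## Located finding
The route `LuscherReduction` (rev 12) consumes the XL child `TwistedTraceScaling` (TTS) ONLY through the upper half of the coarse two-sided level law,
i.e. through KT's precision-free `CoarseNoIntruder` (`TraceDoor.coarseNoIntruder_of_coarseLevels`; skeleton «KTR» r8 PART 5 §5).  The LOWER half of
what the trace inversion delivers is never used — and it is in fact FREE: the sibling child `DressedRitz` (i)+(iii) with the tree's Rayleigh–Ritz
inequality `KTDoorR3.ritzBasicsR3` gives `λ_j/λ_0 ≥ e^{−(Cλ+η)λ/L}·μ_j/μ_0` for every `j ≤ k`, eventually.  Feeding these lower bounds INTO the trace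
comparison turns a ONE-SIDED trace inequality into the no-intruder law ("sandwich": one-sided trace information + opposite-sided level information
⟹ two-sided levels; a missing level cannot hide an intruder because the levels below it are pinned from below).

## The typed replacement candidate (same currency as TTS: `TT.physTrace`, `femtoSteps`, `oneSiteCoupling`; strictly one-sided)
`UpperTraceLaw` (UTL): for every femto-time `s > 0` and `ε > 0`, deep in the window, at `T = ⌈sL/λ⌉`, `B = 2L³/λ³`:
`Z_phys(L,β,T) ≤ (Z_phys(1,B,T)/μ_0(B)^T + ε)·λ_0(L,β)^T` — in level currency (`TraceFormula`, CLOSED): `Σ_j (λ_j/λ_0)^T ≤ Σ_i (μ_i/μ_0)^T + ε`: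
"no excess low-lying zero-flux spectral weight relative to the one-site tower".  One-sided ⇒ operator/trace-MONOTONICITY tools (comparison
transfer operators, Feynman–Kac domination, IMS upper bounds on `P K_β^T P`) become admissible, which the two-sided ratio law excludes; the vacuum
normalisation `λ_0^T` is discharged from above by `DressedRitz (iii)` and from below by any trial state.

## Theorems (all over tree modules; children `TraceFormula` (20202) and `OneSiteTail` (20204), ONE = `OneSiteLevels`, `RitzBasics`, the Kato–Temple door
## and the KT composition `TraceDoor.runningReduction_of_coarseNoIntruder` are CLOSED / LANDED in the tree and used by name)
* §2 `coarseNoIntruder_of_upperTraceLaw : UpperTraceLaw → OneSiteTail → DressedRitz → ⟨VERBATIM body of KT.CoarseNoIntruder⟩` (the sandwich, REAL proof),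
  `coarseNoIntruder_of_upperTraceLaw'` (with `OST.oneSiteTail_proof`).
* §3 ★ `runningReduction_of_upperTraceLaw : UpperTraceLaw → Theses.LuscherReduction.DressedRitz → Theses.LuscherReduction.RunningReduction` — RED BY NAME
  (composition with the landed `Theorems/LuscherReductionTraceDoorKT.lean`).
* §4 certificates that UTL is NOT stronger than what the children already give: `femtoWeyl_of_twistedTraceScaling` (`TTS ∧ OneSiteTail ⟹ FemtoWeyl`:
  `𝔷_L(T) ≤ 1/r_L(T) ≤ 2(K+1)²`), `upperTraceLaw_of_coarseLevels` (`CoarseLevels ∧ FemtoWeyl ⟹ UTL`, ONE by name) and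
  `upperTraceLaw_of_twistedTraceScaling : CoarseLevels → TwistedTraceScaling → UpperTraceLaw`; with the skeleton's trace inversion INV
  (`TF ∧ TTS ∧ OneSiteTail ⟹ CoarseLevels`, ktr.lean PART 6, tree-pending `TraceDoorInv*`) this closes the loop: modulo the closed children,
  TTS ⟹ UTL, and modulo `DressedRitz` as well `UTL ⟹ CoarseNoIntruder` — what TTS asserts beyond UTL (two-sidedness of the dyadic law, the
  full-torus tail as an output) is never consumed by the route.

## GEN 8 (rev 3, 2026-08-27): INV landed ⇒ the loop is CLOSED IN THE TREE
* §5 `upperTraceLaw_of_twistedTraceScaling' : TwistedTraceScaling → UpperTraceLaw` — NO side hypothesis (the trace inversion INV is the landed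
  `TraceDoor.coarseLevels_of_twistedTraceScaling`, `Theorems/LuscherReductionTraceDoorCorollary.lean`); `femtoWeyl_of_twistedTraceScaling'`.
* §6 ★★ `twistedTraceScaling_of_upperTraceLaw : UpperTraceLaw → OneSiteTail → DressedRitz → TwistedTraceScaling` (REAL proof: UTL at `s` and `2s`,
  antitonicity in `T`, one-site one-step robustness, the dressed-Ritz lower jaw of §2, and the ratio rule `|b/a² − b₁/a₁²| ≤ |b−b₁| + 2|a−a₁|`),
  `twistedTraceScaling_of_upperTraceLaw'` (child `OneSiteTail` closed), `upperTraceLaw_iff_twistedTraceScaling : DressedRitz → (UpperTraceLaw ↔ TwistedTraceScaling)`,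
  `runningReduction_of_upperTraceLaw_viaTTS`.  UPSHOT: given the sibling child `DressedRitz` (20205) the cuts `{TwistedTraceScaling, DressedRitz}` (route rev 12)
  and `{UpperTraceLaw, DressedRitz}` of RED are LOGICALLY IDENTICAL; the pivot `TwistedTraceScaling ↦ UpperTraceLaw` changes only the SHAPE of the
  prover's target (one vacuum-normalised inequality, monotone under extra spectral weight), never the strength of the route.

HONEST FRAMING: femto rung R2b1 (`FemtoGapOfRecord`) bookkeeping; the XL content (UTL resp. TTS, `DressedRitz`) is ASSUMED; nothing here bears on
infinite volume, the continuum limit in large volume, or the Clay mass gap.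
-/

set_option autoImplicit false

noncomputable section

open MeasureTheory Filter Topology Real
open Literature.MathematicalPhysics.QuantumFieldTheory hiding SU2
open Literature.MathematicalPhysics.QuantumLattice
open Literature.Analysis.OperatorTheory.YMMatrixModel
open scoped BigOperators

namespace Summit.QuantumFields.YangMills.Cruxes.RunningReduction.UTD

open Summit.QuantumFields.YangMills.Theorems.FemtoTransferGap
open Summit.QuantumFields.YangMills.Theorems.FemtoTransferGap.TT (physTrace)
open Summit.QuantumFields.YangMills.Theorems.FemtoTransferGap.TraceDoor
open Summit.QuantumFields.YangMills.Theorems.FemtoTransferGap.KTRCalibration (levelValue_antitone)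
open Summit.QuantumFields.YangMills.Theses.LuscherReduction (RunningReduction TwistedTraceScaling DressedRitz TraceFormula OneSiteTail)

/-! ## §1 Statements -/

/-- **`UpperTraceLaw`** (UTL; ONE-SIDED replacement candidate for the child `TwistedTraceScaling`): for every femto-time `s > 0` and `ε > 0`, deep in
the femto window, the zero-flux partition function at `T = ⌈sL/λ⌉` steps is at most the one-site one (at `B = 2L³/λ³`, same `T`), both in units of
their vacuum: `Z_phys(L,β,T) ≤ (Z_phys(1,B,T)/μ_0^T + ε)·λ_0^T`.  [cite: Luscher1983, §3] [cite: Balaban1989LargeFieldII, p.355] -/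
def UpperTraceLaw : Prop :=
  ∀ s : ℝ, 0 < s → ∀ ε : ℝ, 0 < ε → ∃ lam0 : ℝ, 0 < lam0 ∧ ∀ lam : ℝ, 0 < lam → lam ≤ lam0 →
    ∃ L0 : ℕ, ∀ (L : ℕ) [NeZero L], L0 ≤ L → ∀ β : ℝ, InFemtoWindow lam β L →
      physTrace L β (femtoSteps s β L) ≤
        (physTrace 1 (oneSiteCoupling β L) (femtoSteps s β L) / levelValue su2Rep 1 (oneSiteCoupling β L) 0 ^ femtoSteps s β L + ε) *
          levelValue su2Rep L β 0 ^ femtoSteps s β L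

/-- **`FemtoWeyl`**: uniform boundedness of the vacuum-normalised femto partition function at SOME femto-time — `Z_phys(L,β,⌈s₀L/λ⌉) ≤ C·λ_0^{⌈s₀L/λ⌉}`
deep in the window ("no accumulation of zero-flux levels below energy `O(λ/L)` beyond a Laplace-summable tower"; the full-theory analogue of the
child `OneSiteTail`).  Implied by UTL (with `OneSiteTail`) and by TTS (with `OneSiteTail`): §4. [cite: Luscher1983, §3] -/
def FemtoWeyl : Prop :=
  ∀ s0 : ℝ, 0 < s0 → ∃ C : ℝ, ∃ lam0 : ℝ, 0 < lam0 ∧ ∀ lam : ℝ, 0 < lam → lam ≤ lam0 →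
    ∃ L0 : ℕ, ∀ (L : ℕ) [NeZero L], L0 ≤ L → ∀ β : ℝ, InFemtoWindow lam β L →
      physTrace L β (femtoSteps s0 β L) ≤ C * levelValue su2Rep L β 0 ^ femtoSteps s0 β L

/-- KT's precision-free no-intruder law (VERBATIM body of `KT.CoarseNoIntruder`, skeleton «KTR»; = the conclusion of the tree's
`TraceDoor.coarseNoIntruder_of_coarseLevels`). -/
def CoarseNoIntruder : Prop :=
  ∀ k : ℕ, ∀ d : ℝ, d < levelGap k → ∃ lam0 : ℝ, 0 < lam0 ∧ ∀ lam : ℝ, 0 < lam → lam ≤ lam0 →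
    ∃ L0 : ℕ, ∀ (L : ℕ) [NeZero L], L0 ≤ L → ∀ β : ℝ, InFemtoWindow lam β L →
      levelValue su2Rep L β k ≤ Real.exp (-(d * luscherLambda β L) / L) * levelValue su2Rep L β 0

/-- The coarse two-sided level law (VERBATIM body of `TT.CoarseLevels`, skeleton «KTR» PART 5; = the hypothesis of the tree's
`TraceDoor.coarseNoIntruder_of_coarseLevels`). -/
def CoarseLevels : Prop :=
  ∀ k : ℕ, ∀ η : ℝ, 0 < η → ∃ lam0 : ℝ, 0 < lam0 ∧ ∀ lam : ℝ, 0 < lam → lam ≤ lam0 →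
    ∃ L0 : ℕ, ∀ (L : ℕ) [NeZero L], L0 ≤ L → ∀ β : ℝ, InFemtoWindow lam β L →
      Real.exp (-((levelGap k + η) * luscherLambda β L) / L) * levelValue su2Rep L β 0 ≤ levelValue su2Rep L β k ∧
        levelValue su2Rep L β k ≤ Real.exp (-((levelGap k - η) * luscherLambda β L) / L) * levelValue su2Rep L β 0

/-! ## §1b Elementary facts -/

/-- `1 − e^{−u} ≤ u` (convexity). -/
theorem one_sub_exp_neg_le (u : ℝ) : 1 - Real.exp (-u) ≤ u := by
  have := Real.add_one_le_exp (-u)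
  linarith

/-- Tails of a nonnegative summable sequence decrease under further shifts (skeleton PART 8 `OST.tsum_shift_le`). -/
theorem tsum_shift_le {f : ℕ → ℝ} (hf : Summable f) (h0 : ∀ k, 0 ≤ f k) (K d : ℕ) :
    ∑' k, f (k + (K + d)) ≤ ∑' k, f (k + K) := by
  have hg : Summable (fun k => f (k + K)) := (summable_nat_add_iff K).2 hf
  have h := hg.sum_add_tsum_nat_add d
  have h1 : (fun k => f (k + (K + d))) = fun i => f (i + d + K) := by
    funext i; congr 1; omega
  have h2 : 0 ≤ ∑ i ∈ Finset.range d, f (i + K) := Finset.sum_nonneg fun i _ => h0 _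
  rw [h1]
  linarith

/-- Currency bridge (from the CLOSED child `TraceFormula`): `Σ_j (λ_j/λ_0)^T = Z_phys(T)/λ_0^T` for `β ≥ 1`, `T ≥ 2`. -/
theorem hasSum_xval_pow {L : ℕ} [NeZero L] {β : ℝ} (hβ : 1 ≤ β) {T : ℕ} (hT : 2 ≤ T) :
    HasSum (fun j => xval L β j ^ T) (physTrace L β T / levelValue su2Rep L β 0 ^ T) := by
  have h := (TT.traceFormula_proof L β T hβ hT).div_const (levelValue su2Rep L β 0 ^ T)
  refine h.congr_fun ?_
  intro j
  unfold xval; rw [div_pow]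

theorem xval_nonneg {L : ℕ} [NeZero L] {β : ℝ} (hβ : 1 ≤ β) (j : ℕ) : 0 ≤ xval L β j :=
  div_nonneg (transferValuesNonneg L β j hβ) (levelValue_zero_su2Rep_pos L β).le

theorem xval_le_one {L : ℕ} [NeZero L] {β : ℝ} (hβ : 1 ≤ β) (j : ℕ) : xval L β j ≤ 1 := by
  unfold xval
  rw [div_le_one (levelValue_zero_su2Rep_pos L β)]
  exact levelValue_antitone (zero_le_one.trans hβ) (Nat.zero_le j)

theorem xval_le_xval {L : ℕ} [NeZero L] {β : ℝ} (hβ : 1 ≤ β) {i j : ℕ} (hij : i ≤ j) : xval L β j ≤ xval L β i := by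
  unfold xval
  exact div_le_div_of_nonneg_right (levelValue_antitone (zero_le_one.trans hβ) hij) (levelValue_zero_su2Rep_pos L β).le

/-- `s ≤ T·(λ/L) ≤ s + λ/L` at `T = femtoSteps s β L` (`s ≥ 0`, `λ > 0`). -/
theorem femtoSteps_mul_bounds {s β : ℝ} {L : ℕ} [NeZero L] (hs : 0 ≤ s) (hl : 0 < luscherLambda β L) :
    s ≤ (femtoSteps s β L : ℝ) * (luscherLambda β L / L) ∧
      (femtoSteps s β L : ℝ) * (luscherLambda β L / L) ≤ s + luscherLambda β L / L := by
  have hL0 : (0 : ℝ) < (L : ℝ) := by exact_mod_cast Nat.pos_of_ne_zero (NeZero.ne L)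
  have hu : 0 < luscherLambda β L / L := div_pos hl hL0
  have hx : 0 ≤ s * L / luscherLambda β L := by positivity
  have hc1 : s * L / luscherLambda β L ≤ (femtoSteps s β L : ℝ) := Nat.le_ceil _
  have hc2 : (femtoSteps s β L : ℝ) < s * L / luscherLambda β L + 1 := Nat.ceil_lt_add_one hx
  have e1 : s * L / luscherLambda β L * (luscherLambda β L / L) = s := by field_simp
  constructor
  · calc s = s * L / luscherLambda β L * (luscherLambda β L / L) := e1.symm
      _ ≤ (femtoSteps s β L : ℝ) * (luscherLambda β L / L) := mul_le_mul_of_nonneg_right hc1 hu.le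
  · have : (femtoSteps s β L : ℝ) * (luscherLambda β L / L) ≤ (s * L / luscherLambda β L + 1) * (luscherLambda β L / L) :=
      mul_le_mul_of_nonneg_right hc2.le hu.le
    have e2 : (s * L / luscherLambda β L + 1) * (luscherLambda β L / L) = s + luscherLambda β L / L := by rw [add_mul, e1, one_mul]
    linarith

theorem femtoSteps_mono {s s' β : ℝ} {L : ℕ} (h : s ≤ s') (hl : 0 ≤ luscherLambda β L) : femtoSteps s β L ≤ femtoSteps s' β L := by
  unfold femtoSteps
  apply Nat.ceil_mono
  exact div_le_div_of_nonneg_right (mul_le_mul_of_nonneg_right h (Nat.cast_nonneg L)) hl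

/-- One-site COARSE UPPER law at a single level from the closed crux ONE: `μ_j ≤ e^{−(Δ_j−ε)λ_b} μ_0` for `B ≥ B0(j,ε)`. -/
theorem oneSiteUpper_single (j : ℕ) {ε : ℝ} (hε : 0 < ε) : ∃ B0 : ℝ, ∀ B : ℝ, B0 ≤ B →
    0 < levelValue su2Rep 1 B 0 ∧ levelValue su2Rep 1 B j ≤ Real.exp (-((levelGap j - ε) * bareLambda B)) * levelValue su2Rep 1 B 0 := by
  obtain ⟨C, B0, hB⟩ := Summit.QuantumFields.YangMills.Theorems.FemtoTransferGap.oneSiteLevels_proof j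
  have hC'pos : 0 < max C 1 := lt_of_lt_of_le one_pos (le_max_right _ _)
  have htpos : 0 < ε / max C 1 := div_pos hε hC'pos
  refine ⟨max B0 (max (2 / (ε / max C 1) ^ 3) 1), fun B hBge => ?_⟩
  have hB0 : B0 ≤ B := (le_max_left _ _).trans hBge
  have hBt : 2 / (ε / max C 1) ^ 3 ≤ B := ((le_max_left _ _).trans (le_max_right _ _)).trans hBge
  have hB1 : 1 ≤ B := ((le_max_right _ _).trans (le_max_right _ _)).trans hBge
  have hBpos : 0 < B := one_pos.trans_le hB1
  obtain ⟨hpos, hup, _⟩ := hB B hB0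
  refine ⟨hpos, ?_⟩
  have hlam : bareLambda B ≤ ε / max C 1 := bareLambda_le_of_le htpos hBt
  have hlam0 : 0 < bareLambda B := bareLambda_pos' hBpos
  have hCl : C * bareLambda B ^ 2 ≤ ε * bareLambda B := by
    have h1 : C * bareLambda B ^ 2 ≤ max C 1 * bareLambda B ^ 2 :=
      mul_le_mul_of_nonneg_right (le_max_left _ _) (sq_nonneg _)
    have h2 : max C 1 * bareLambda B ≤ ε := by
      have h3 := mul_le_mul_of_nonneg_left hlam hC'pos.le
      have e : max C 1 * (ε / max C 1) = ε := by field_simp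
      linarith
    have h3 : max C 1 * bareLambda B ^ 2 ≤ ε * bareLambda B := by
      have h4 := mul_le_mul_of_nonneg_right h2 hlam0.le
      rw [sq, ← mul_assoc]; exact h4
    linarith
  calc levelValue su2Rep 1 B j ≤ Real.exp (-(levelGap j * bareLambda B - C * bareLambda B ^ 2)) * levelValue su2Rep 1 B 0 := hup
    _ ≤ Real.exp (-((levelGap j - ε) * bareLambda B)) * levelValue su2Rep 1 B 0 := by
        apply mul_le_mul_of_nonneg_right _ hpos.le
        apply Real.exp_le_exp.mpr
        nlinarith only [hCl]

/-! ## §2 The sandwich: `UpperTraceLaw ∧ OneSiteTail ∧ DressedRitz ⟹ CoarseNoIntruder`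

Parameter order (given `k`, `d < Δ = Δ_k`, WLOG `d > 0`): `η₂ = (Δ−d)/4`; `OneSiteTail` at `(s₀,ε₀) = (1,1)` gives `K₀, B₁`; `N = max K₀ (k+1)`;
ONE's coarse upper law at levels `k`, `k+1` with precision `η₂` gives `B₂, B₃`; `M = 1 + (N−k)e^{3(d+3η₂)/2}`;
`s = max 2 (log(3e^d M)/(3η₂))`; `ε = (e^{−d}/3)e^{−ds}` (UTL precision); `η = ε/(2(k+1)(s+1))` (DressedRitz precision, gives `C`);
`lam0 = min(lam_U, lam_R, 1/8, η/(2C⁺+1), 1/(4B*))`.  Deep in the window, at `T = ⌈sL/λ⌉`, `T₁ = ⌈L/(2λ)⌉`, `x = λ/L`, `τ = Tx ∈ [s, s+x]`: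
`ρ^T Σ_{j<k} y_j^T + x_k^T ≤ Σ_{j≤k} x_j^T ≤ Σ_j x_j^T ≤ Σ_i y_i^T + ε` (lower bounds `x_j ≥ ρ y_j`, `ρ = e^{−(C⁺λ+η)x}`, from DressedRitz (i),(iii)
+ RitzBasics; UTL in level currency via the closed `TraceFormula`), and `Σ_i y_i^T ≤ Σ_{j<k} y_j^T + y_k^T + (N−k−1)y_{k+1}^{T} + y_{N}^{T−T₁}·Σ_i y_{i+N}^{T₁}`
with the last tail `≤ 1` (OneSiteTail at `T₁`, shifted from `K₀` to `N`); ONE bounds `y_k ≤ e^{−(Δ−η₂)x}`, `y_{k+1} ≤ e^{−(Δ−η₂)x}`; hence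
`x_k^T ≤ 2ε + M e^{−(d+3η₂)s} ≤ 3ε = e^{−d(s+1)} ≤ e^{−dτ} = (e^{−dx})^T`, i.e. `x_k ≤ e^{−dx}`. -/

set_option maxHeartbeats 1600000 in
/-- ★ **The sandwich.**  `UpperTraceLaw ∧ OneSiteTail ∧ DressedRitz ⟹ KT.CoarseNoIntruder` (the CLOSED children `TraceFormula`, ONE and the tree's
`ritzBasicsR3` are used by name).  [cite: Luscher1983, §3] [cite: ReedSimonIV1978, Thm. XIII.1] -/
theorem coarseNoIntruder_of_upperTraceLaw (hU : UpperTraceLaw) (hOST : OneSiteTail) (hDR : DressedRitz) : CoarseNoIntruder := by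
  intro k d hd
  -- (0) the trivial case `d ≤ 0`
  rcases le_or_gt d 0 with hd0 | hd0
  · refine ⟨1, one_pos, fun lam hlam _ => ⟨0, fun L _ _ β hW => ?_⟩⟩
    have hβ : (1 : ℝ) ≤ β := hW.1
    have hl : 0 < luscherLambda β L := luscherLambda_pos_of_window hlam hW
    have hL0 : (0 : ℝ) < L := Nat.cast_pos.mpr (NeZero.pos L)
    have h1 : levelValue su2Rep L β k ≤ levelValue su2Rep L β 0 := levelValue_antitone (zero_le_one.trans hβ) (Nat.zero_le k)
    have h2 : (1 : ℝ) ≤ Real.exp (-(d * luscherLambda β L) / L) := by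
      apply Real.one_le_exp
      have : 0 ≤ -d * luscherLambda β L := mul_nonneg (by linarith only [hd0]) hl.le
      exact div_nonneg (by linarith only [this]) hL0.le
    calc levelValue su2Rep L β k ≤ 1 * levelValue su2Rep L β 0 := by rw [one_mul]; exact h1
      _ ≤ _ := mul_le_mul_of_nonneg_right h2 (levelValue_zero_su2Rep_pos L β).le
  -- (1) constants fixed by `(k, d)` only
  set Δ : ℝ := levelGap k with hΔdef
  have hgap : 0 < Δ - d := sub_pos.mpr hd
  set η₂ : ℝ := (Δ - d) / 4 with hη₂def
  have hη₂ : 0 < η₂ := div_pos hgap (by norm_num)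
  have hΔeq : Δ - η₂ = d + 3 * η₂ := by rw [hη₂def]; ring
  have hrate : 0 < d + 3 * η₂ := by linarith only [hd0, hη₂]
  obtain ⟨K₀, B₁, hT1⟩ := hOST 1 one_pos 1 one_pos
  set N : ℕ := max K₀ (k + 1) with hNdef
  have hNK : K₀ ≤ N := le_max_left _ _
  have hNk : k + 1 ≤ N := le_max_right _ _
  have hNkr : (k : ℝ) + 1 ≤ N := by exact_mod_cast hNk
  obtain ⟨B₂, hB₂⟩ := oneSiteUpper_single k hη₂
  obtain ⟨B₃, hB₃⟩ := oneSiteUpper_single (k + 1) hη₂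
  set Bs : ℝ := max (max B₁ B₂) (max B₃ 1) with hBsdef
  have hBs1 : 1 ≤ Bs := (le_max_right _ _).trans (le_max_right _ _)
  have hBspos : 0 < Bs := one_pos.trans_le hBs1
  set A : ℝ := Real.exp (3 * (d + 3 * η₂) / 2) with hAdef
  have hApos : 0 < A := Real.exp_pos _
  set M : ℝ := 1 + ((N : ℝ) - k) * A with hMdef
  have hNk0 : (0 : ℝ) ≤ (N : ℝ) - k := by linarith only [hNkr]
  have hM1 : 1 ≤ M := by
    have : 0 ≤ ((N : ℝ) - k) * A := mul_nonneg hNk0 hApos.le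
    linarith only [this]
  have hMpos : 0 < M := one_pos.trans_le hM1
  set s : ℝ := max 2 (Real.log (3 * Real.exp d * M) / (3 * η₂)) with hsdef
  have hs2 : 2 ≤ s := le_max_left _ _
  have hspos : 0 < s := by linarith only [hs2]
  have hsM : M * Real.exp (-(3 * η₂ * s)) ≤ Real.exp (-d) / 3 := by
    have h1 : Real.log (3 * Real.exp d * M) / (3 * η₂) ≤ s := le_max_right _ _
    have h2 : Real.log (3 * Real.exp d * M) ≤ 3 * η₂ * s := by
      rw [div_le_iff₀ (by positivity)] at h1; linarith only [h1]
    have h3 : 3 * Real.exp d * M ≤ Real.exp (3 * η₂ * s) := by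
      have := Real.exp_le_exp.mpr h2
      rwa [Real.exp_log (by positivity)] at this
    have hE : 0 < Real.exp (3 * η₂ * s) := Real.exp_pos _
    have hdd : Real.exp (-d) * Real.exp d = 1 := by rw [← Real.exp_add, neg_add_cancel, Real.exp_zero]
    rw [Real.exp_neg (3 * η₂ * s)]
    rw [mul_inv_le_iff₀ hE]
    -- `M ≤ e^{-d}/3 · e^{3η₂ s}`
    calc M = Real.exp (-d) / 3 * (3 * Real.exp d * M) := by
          rw [show Real.exp (-d) / 3 * (3 * Real.exp d * M) = (Real.exp (-d) * Real.exp d) * M by ring, hdd, one_mul]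
      _ ≤ Real.exp (-d) / 3 * Real.exp (3 * η₂ * s) := mul_le_mul_of_nonneg_left h3 (by positivity)
  set ε : ℝ := Real.exp (-d) / 3 * Real.exp (-(d * s)) with hεdef
  have hε : 0 < ε := mul_pos (div_pos (Real.exp_pos _) (by norm_num)) (Real.exp_pos _)
  set η : ℝ := ε / (2 * ((k : ℝ) + 1) * (s + 1)) with hηdef
  have hden : 0 < 2 * ((k : ℝ) + 1) * (s + 1) := by positivity
  have hη : 0 < η := div_pos hε hden
  obtain ⟨lamU, hlamU, hUs⟩ := hU s hspos ε hε
  obtain ⟨C, lamR, hlamR, hR⟩ := hDR k η hη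
  set C1 : ℝ := max C 0 with hC1def
  have hC10 : 0 ≤ C1 := le_max_right _ _
  have hCC1 : C ≤ C1 := le_max_left _ _
  have h2C1 : 0 < 2 * C1 + 1 := by linarith only [hC10]
  have hq1 : 0 < η / (2 * C1 + 1) := div_pos hη h2C1
  have hq2 : 0 < 1 / (4 * Bs) := by positivity
  refine ⟨min (min lamU lamR) (min (1 / 8) (min (η / (2 * C1 + 1)) (1 / (4 * Bs)))),
    lt_min (lt_min hlamU hlamR) (lt_min (by norm_num) (lt_min hq1 hq2)), fun lam hlam hlamle => ?_⟩
  have hlamU' : lam ≤ lamU := hlamle.trans ((min_le_left _ _).trans (min_le_left _ _))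
  have hlamR' : lam ≤ lamR := hlamle.trans ((min_le_left _ _).trans (min_le_right _ _))
  have hlam8 : lam ≤ 1 / 8 := hlamle.trans ((min_le_right _ _).trans (min_le_left _ _))
  have hlamη : lam ≤ η / (2 * C1 + 1) :=
    hlamle.trans ((min_le_right _ _).trans ((min_le_right _ _).trans (min_le_left _ _)))
  have hlamB : lam ≤ 1 / (4 * Bs) :=
    hlamle.trans ((min_le_right _ _).trans ((min_le_right _ _).trans (min_le_right _ _)))
  obtain ⟨L0U, hL0U⟩ := hUs lam hlam hlamU'
  obtain ⟨L0R, hL0R⟩ := hR lam hlam hlamR'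
  refine ⟨max L0U L0R, fun L _ hL β hW => ?_⟩
  have hLU : L0U ≤ L := (le_max_left _ _).trans hL
  have hLR : L0R ≤ L := (le_max_right _ _).trans hL
  -- the two eventual hypotheses at this `(L, β)`
  have hUTL := hL0U L hLU β hW
  obtain ⟨φ, hφphys, hφon, hφdiag, hφanti, hratio, -, hcap⟩ := hL0R L hLR β hW
  have hB14 : 1 / (4 * lam ^ 3) ≤ oneSiteCoupling β L := oneSiteCoupling_ge_of_window hlam hW
  obtain ⟨hβ, hlamle', hlam2⟩ := hW
  have hβ0 : (0 : ℝ) ≤ β := zero_le_one.trans hβ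
  -- scales
  set l : ℝ := luscherLambda β L with hldef
  have hlpos : 0 < l := hlam.trans_le hlamle'
  have hLpos : (0 : ℝ) < L := Nat.cast_pos.mpr (NeZero.pos L)
  have hL1 : (1 : ℝ) ≤ L := by exact_mod_cast NeZero.one_le
  set x : ℝ := l / L with hxdef
  have hxpos : 0 < x := div_pos hlpos hLpos
  have hxl : x ≤ l := div_le_self hlpos.le hL1
  have hl14 : l ≤ 1 / 4 := by linarith only [hlam2, hlam8]
  have hx1 : x ≤ 1 := by linarith only [hxl, hl14]
  have hlx : 0 < l * x := mul_pos hlpos hxpos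
  -- the one-site coupling is beyond every threshold
  set B : ℝ := oneSiteCoupling β L with hBdef
  have hBge : Bs ≤ B := by
    have hlam1 : lam ≤ 1 := by linarith only [hlam8]
    have h3 : lam ^ 3 ≤ lam := by
      have := pow_le_pow_of_le_one hlam.le hlam1 (show 1 ≤ 3 by norm_num)
      rwa [pow_one] at this
    have h4 : lam * (4 * Bs) ≤ 1 := by rwa [le_div_iff₀ (by positivity)] at hlamB
    have h5 : Bs ≤ 1 / (4 * lam ^ 3) := by
      rw [le_div_iff₀ (by positivity)]
      calc Bs * (4 * lam ^ 3) = (4 * Bs) * lam ^ 3 := by ring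
        _ ≤ (4 * Bs) * lam := mul_le_mul_of_nonneg_left h3 (by positivity)
        _ = lam * (4 * Bs) := by ring
        _ ≤ 1 := h4
    exact h5.trans hB14
  have hB1' : B₁ ≤ B := ((le_max_left _ _).trans (le_max_left _ _)).trans hBge
  have hB2' : B₂ ≤ B := ((le_max_right _ _).trans (le_max_left _ _)).trans hBge
  have hB3' : B₃ ≤ B := ((le_max_left _ _).trans (le_max_right _ _)).trans hBge
  have hB1 : 1 ≤ B := hBs1.trans hBge
  have hbl : bareLambda B = x := by rw [hBdef, hxdef, hldef]; exact bareLambda_oneSiteCoupling hlpos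
  have hmu0 : 0 < levelValue su2Rep 1 B 0 := levelValue_zero_su2Rep_pos 1 B
  have hl0 : 0 < levelValue su2Rep L β 0 := levelValue_zero_su2Rep_pos L β
  have hmunn : ∀ i : ℕ, 0 ≤ levelValue su2Rep 1 B i := fun i => transferValuesNonneg 1 B i hB1
  -- times
  set T : ℕ := femtoSteps s β L with hTdef
  set T₁ : ℕ := femtoSteps (1 / 2) β L with hT₁def
  obtain ⟨hτlo0, hτhi0⟩ := femtoSteps_mul_bounds (s := s) (β := β) (L := L) hspos.le hlpos
  obtain ⟨hτ₁lo0, hτ₁hi0⟩ := femtoSteps_mul_bounds (s := 1 / 2) (β := β) (L := L) (by norm_num) hlpos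
  have hτlo : s ≤ (T : ℝ) * x := hτlo0
  have hτhi : (T : ℝ) * x ≤ s + x := hτhi0
  have hτ₁lo : 1 / 2 ≤ (T₁ : ℝ) * x := hτ₁lo0
  have hτ₁hi : (T₁ : ℝ) * x ≤ 1 / 2 + x := hτ₁hi0
  have hT₁T : T₁ ≤ T := femtoSteps_mono (by linarith only [hs2]) hlpos.le
  have hTx : (T : ℝ) * x ≤ T := (mul_le_mul_of_nonneg_left hx1 (Nat.cast_nonneg T)).trans_eq (mul_one _)
  have hT2r : (2 : ℝ) ≤ T := by linarith only [hs2, hτlo, hTx]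
  have hT2 : 2 ≤ T := by exact_mod_cast hT2r
  have hTpos : 0 < T := by omega
  have hτ1 : (T : ℝ) * x ≤ s + 1 := by linarith only [hτhi, hx1]
  have hsub : (((T - T₁ : ℕ) : ℝ)) = (T : ℝ) - T₁ := Nat.cast_sub hT₁T
  have hτdiff : s - 3 / 2 ≤ ((T - T₁ : ℕ) : ℝ) * x := by
    rw [hsub]; linarith only [hτlo, hτ₁hi, hx1]
  -- the trace laws in level currency (closed `TraceFormula`)
  have hHS := hasSum_xval_pow (L := L) (β := β) hβ hT2
  have hHS1 := hasSum_xval_pow (L := 1) (β := B) hB1 hT2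
  -- normalised levels
  set y : ℕ → ℝ := xval 1 B with hydef
  set z : ℕ → ℝ := xval L β with hzdef
  have hy0 : ∀ i, 0 ≤ y i := fun i => xval_nonneg hB1 i
  have hy1 : ∀ i, y i ≤ 1 := fun i => xval_le_one hB1 i
  have hymono : ∀ {i j : ℕ}, i ≤ j → y j ≤ y i := fun hij => xval_le_xval hB1 hij
  have hz0 : ∀ j, 0 ≤ z j := fun j => xval_nonneg hβ j
  -- OneSiteTail at `T₁` and at `T`
  have hadm₁ : (1 : ℝ) ≤ 2 * ((T₁ : ℝ) * bareLambda B) := by rw [hbl]; linarith only [hτ₁lo]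
  have hadm : (1 : ℝ) ≤ 2 * ((T : ℝ) * bareLambda B) := by rw [hbl]; linarith only [hτlo, hs2]
  obtain ⟨hsumT₁, htailT₁⟩ := hT1 B hB1' T₁ hadm₁
  obtain ⟨hsumT, -⟩ := hT1 B hB1' T hadm
  have hsumT₁' : Summable (fun i => y i ^ T₁) := hsumT₁
  have hsumT' : Summable (fun i => y i ^ T) := hsumT
  have htailT₁' : ∑' i, y (i + K₀) ^ T₁ ≤ 1 := htailT₁
  have hsumz : Summable (fun j => z j ^ T) := hHS.summable
  have hUTL' : ∑' j, z j ^ T ≤ ∑' i, y i ^ T + ε := by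
    rw [hHS.tsum_eq, hHS1.tsum_eq, div_le_iff₀ (pow_pos hl0 T)]
    exact hUTL
  -- the dressed Ritz family: top capture and lower bounds `ρ y_j ≤ x_j` for `j ≤ k`
  have hritzle := KTDoorR3.ritzBasicsR3 L β (k + 1) φ hβ hφphys hφon hφdiag hφanti
  have hmnn : ∀ i, 0 ≤ qform su2Rep β (φ i) (φ i) := fun i => ritz_nonneg hβ (hφphys i)
  set m0 : ℝ := qform su2Rep β (φ 0) (φ 0) with hm0def
  have hm0nn : 0 ≤ m0 := hmnn 0
  have e_eta : η * l / (L : ℝ) = η * x := by rw [hxdef]; ring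
  have hcap' : levelValue su2Rep L β 0 ≤ Real.exp (η * x) * m0 := by
    refine levelValue_zero_le_of_forall_rayleigh_le su2Rep β (mul_nonneg (Real.exp_pos _).le hm0nn) fun ψ hψ _ => ?_
    have h1 := hcap ψ hψ
    rw [e_eta] at h1
    exact h1
  have hcap'' : Real.exp (-(η * x)) * levelValue su2Rep L β 0 ≤ m0 := by
    rw [Real.exp_neg, inv_mul_le_iff₀ (Real.exp_pos _)]; exact hcap'
  set ρ : ℝ := Real.exp (-((C1 * l + η) * x)) with hρdef
  have hρpos : 0 < ρ := Real.exp_pos _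
  have hClη : 0 ≤ (C1 * l + η) * x := by positivity
  have hρ1 : ρ ≤ 1 := by
    rw [hρdef]; exact Real.exp_le_one_iff.mpr (by linarith only [hClη])
  have e_lx : C * l ^ 2 / (L : ℝ) = C * (l * x) := by rw [hxdef]; ring
  have hexpC : Real.exp (C * l ^ 2 / L) ≤ Real.exp (C1 * (l * x)) := by
    rw [e_lx]; exact Real.exp_le_exp.mpr (mul_le_mul_of_nonneg_right hCC1 hlx.le)
  have hlow : ∀ j : ℕ, j ≤ k → ρ * y j ≤ z j := by
    intro j hj
    have hjlt : j < k + 1 := Nat.lt_succ_of_le hj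
    obtain ⟨-, hb⟩ := hratio ⟨j, hjlt⟩
    have hmj : qform su2Rep β (φ ⟨j, hjlt⟩) (φ ⟨j, hjlt⟩) ≤ levelValue su2Rep L β j := hritzle ⟨j, hjlt⟩
    have hb' : levelValue su2Rep 1 B j * m0 ≤
        Real.exp (C * l ^ 2 / L) * (qform su2Rep β (φ ⟨j, hjlt⟩) (φ ⟨j, hjlt⟩) * levelValue su2Rep 1 B 0) := hb
    have h1 : levelValue su2Rep 1 B j * m0 ≤ Real.exp (C1 * (l * x)) * (levelValue su2Rep L β j * levelValue su2Rep 1 B 0) :=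
      calc levelValue su2Rep 1 B j * m0
          ≤ Real.exp (C * l ^ 2 / L) * (qform su2Rep β (φ ⟨j, hjlt⟩) (φ ⟨j, hjlt⟩) * levelValue su2Rep 1 B 0) := hb'
        _ ≤ Real.exp (C1 * (l * x)) * (qform su2Rep β (φ ⟨j, hjlt⟩) (φ ⟨j, hjlt⟩) * levelValue su2Rep 1 B 0) :=
            mul_le_mul_of_nonneg_right hexpC (mul_nonneg (hmnn _) hmu0.le)
        _ ≤ Real.exp (C1 * (l * x)) * (levelValue su2Rep L β j * levelValue su2Rep 1 B 0) :=
            mul_le_mul_of_nonneg_left (mul_le_mul_of_nonneg_right hmj hmu0.le) (Real.exp_pos _).le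
    have key : ρ * levelValue su2Rep 1 B j * levelValue su2Rep L β 0 ≤ levelValue su2Rep L β j * levelValue su2Rep 1 B 0 := by
      have eρ : ρ = Real.exp (-(C1 * (l * x))) * Real.exp (-(η * x)) := by
        rw [hρdef, ← Real.exp_add]; congr 1; ring
      calc ρ * levelValue su2Rep 1 B j * levelValue su2Rep L β 0
          = Real.exp (-(C1 * (l * x))) * (levelValue su2Rep 1 B j * (Real.exp (-(η * x)) * levelValue su2Rep L β 0)) := by
            rw [eρ]; ring
        _ ≤ Real.exp (-(C1 * (l * x))) * (levelValue su2Rep 1 B j * m0) :=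
            mul_le_mul_of_nonneg_left (mul_le_mul_of_nonneg_left hcap'' (hmunn j)) (Real.exp_pos _).le
        _ ≤ Real.exp (-(C1 * (l * x))) * (Real.exp (C1 * (l * x)) * (levelValue su2Rep L β j * levelValue su2Rep 1 B 0)) :=
            mul_le_mul_of_nonneg_left h1 (Real.exp_pos _).le
        _ = levelValue su2Rep L β j * levelValue su2Rep 1 B 0 := by
            rw [← mul_assoc, ← Real.exp_add, neg_add_cancel, Real.exp_zero, one_mul]
    show ρ * (levelValue su2Rep 1 B j / levelValue su2Rep 1 B 0) ≤ levelValue su2Rep L β j / levelValue su2Rep L β 0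
    rw [← mul_div_assoc, div_le_div_iff₀ hmu0 hl0]
    exact key
  -- (2) the counting
  have hfin_z : ∑ j ∈ Finset.range (k + 1), z j ^ T ≤ ∑' j, z j ^ T :=
    hsumz.sum_le_tsum (Finset.range (k + 1)) (fun j _ => pow_nonneg (hz0 j) T)
  have hxlow : ρ ^ T * ∑ j ∈ Finset.range k, y j ^ T + z k ^ T ≤ ∑ j ∈ Finset.range (k + 1), z j ^ T := by
    rw [Finset.sum_range_succ, Finset.mul_sum]
    refine add_le_add ?_ le_rfl
    apply Finset.sum_le_sum
    intro j hj
    have hjk : j ≤ k := (Finset.mem_range.mp hj).le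
    have := pow_le_pow_left₀ (mul_nonneg hρpos.le (hy0 j)) (hlow j hjk) T
    rwa [mul_pow] at this
  have hsplit_y : ∑' i, y i ^ T = ∑ i ∈ Finset.range N, y i ^ T + ∑' i, y (i + N) ^ T :=
    (hsumT'.sum_add_tsum_nat_add N).symm
  have hsplit_y2 : ∑ i ∈ Finset.range N, y i ^ T =
      (∑ i ∈ Finset.range k, y i ^ T + y k ^ T) + ∑ i ∈ Finset.Ico (k + 1) N, y i ^ T := by
    rw [← Finset.sum_range_succ, Finset.sum_range_add_sum_Ico _ hNk]
  have hmid : ∑ i ∈ Finset.Ico (k + 1) N, y i ^ T ≤ ((N : ℝ) - (k + 1)) * y (k + 1) ^ (T - T₁) := by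
    have h1 : ∀ i ∈ Finset.Ico (k + 1) N, y i ^ T ≤ y (k + 1) ^ (T - T₁) := by
      intro i hi
      have hik : k + 1 ≤ i := (Finset.mem_Ico.mp hi).1
      calc y i ^ T ≤ y (k + 1) ^ T := pow_le_pow_left₀ (hy0 i) (hymono hik) T
        _ ≤ y (k + 1) ^ (T - T₁) := pow_le_pow_of_le_one (hy0 _) (hy1 _) (Nat.sub_le T T₁)
    calc ∑ i ∈ Finset.Ico (k + 1) N, y i ^ T ≤ ∑ i ∈ Finset.Ico (k + 1) N, y (k + 1) ^ (T - T₁) := Finset.sum_le_sum h1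
      _ = ((N : ℝ) - (k + 1)) * y (k + 1) ^ (T - T₁) := by
        rw [Finset.sum_const, Nat.card_Ico, nsmul_eq_mul, Nat.cast_sub hNk]; push_cast; ring
  have htail : ∑' i, y (i + N) ^ T ≤ y (k + 1) ^ (T - T₁) := by
    have hsumN₁ : Summable (fun i => y (i + N) ^ T₁) := (summable_nat_add_iff N).2 hsumT₁'
    have hle1 : ∑' i, y (i + N) ^ T₁ ≤ 1 := by
      obtain ⟨dd, hdd⟩ := Nat.exists_eq_add_of_le hNK
      have h := tsum_shift_le (f := fun i => y i ^ T₁) hsumT₁' (fun i => pow_nonneg (hy0 i) _) K₀ dd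
      rw [← hdd] at h
      exact h.trans htailT₁'
    have hterm : ∀ i, y (i + N) ^ T ≤ y (i + N) ^ T₁ * y (k + 1) ^ (T - T₁) := by
      intro i
      have e : T₁ + (T - T₁) = T := Nat.add_sub_cancel' hT₁T
      calc y (i + N) ^ T = y (i + N) ^ T₁ * y (i + N) ^ (T - T₁) := by rw [← pow_add, e]
        _ ≤ y (i + N) ^ T₁ * y (k + 1) ^ (T - T₁) :=
            mul_le_mul_of_nonneg_left (pow_le_pow_left₀ (hy0 _) (hymono (by omega)) _) (pow_nonneg (hy0 _) _)
    have hsumN : Summable (fun i => y (i + N) ^ T) := (summable_nat_add_iff N).2 hsumT'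
    calc ∑' i, y (i + N) ^ T ≤ ∑' i, y (i + N) ^ T₁ * y (k + 1) ^ (T - T₁) := hsumN.tsum_le_tsum hterm (hsumN₁.mul_right _)
      _ = (∑' i, y (i + N) ^ T₁) * y (k + 1) ^ (T - T₁) := tsum_mul_right
      _ ≤ 1 * y (k + 1) ^ (T - T₁) := mul_le_mul_of_nonneg_right hle1 (pow_nonneg (hy0 _) _)
      _ = y (k + 1) ^ (T - T₁) := one_mul _
  -- (3) the pointwise bounds
  set E : ℝ := Real.exp (-((d + 3 * η₂) * s)) with hEdef
  have hyk : y k ^ T ≤ E := by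
    obtain ⟨-, hk⟩ := hB₂ B hB2'
    have h1 : y k ≤ Real.exp (-((Δ - η₂) * x)) := by
      show levelValue su2Rep 1 B k / levelValue su2Rep 1 B 0 ≤ _
      rw [div_le_iff₀ hmu0, ← hbl]; exact hk
    have h2 : (d + 3 * η₂) * s ≤ (d + 3 * η₂) * ((T : ℝ) * x) := mul_le_mul_of_nonneg_left hτlo hrate.le
    calc y k ^ T ≤ Real.exp (-((Δ - η₂) * x)) ^ T := pow_le_pow_left₀ (hy0 k) h1 T
      _ = Real.exp (-((d + 3 * η₂) * ((T : ℝ) * x))) := by rw [← Real.exp_nat_mul, hΔeq]; congr 1; ring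
      _ ≤ E := Real.exp_le_exp.mpr (by linarith only [h2])
  have hyk1 : y (k + 1) ^ (T - T₁) ≤ A * E := by
    obtain ⟨-, hk⟩ := hB₃ B hB3'
    have hgapmono : Δ ≤ levelGap (k + 1) := levelGap_mono (Nat.le_succ k)
    have h0 : (Δ - η₂) * x ≤ (levelGap (k + 1) - η₂) * x := mul_le_mul_of_nonneg_right (by linarith only [hgapmono]) hxpos.le
    have h1 : y (k + 1) ≤ Real.exp (-((Δ - η₂) * x)) := by
      show levelValue su2Rep 1 B (k + 1) / levelValue su2Rep 1 B 0 ≤ _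
      rw [div_le_iff₀ hmu0]
      calc levelValue su2Rep 1 B (k + 1) ≤ Real.exp (-((levelGap (k + 1) - η₂) * bareLambda B)) * levelValue su2Rep 1 B 0 := hk
        _ ≤ Real.exp (-((Δ - η₂) * x)) * levelValue su2Rep 1 B 0 := by
            apply mul_le_mul_of_nonneg_right _ hmu0.le
            rw [hbl]; exact Real.exp_le_exp.mpr (by linarith only [h0])
    have h2 : (d + 3 * η₂) * (s - 3 / 2) ≤ (d + 3 * η₂) * (((T - T₁ : ℕ) : ℝ) * x) := mul_le_mul_of_nonneg_left hτdiff hrate.le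
    calc y (k + 1) ^ (T - T₁) ≤ Real.exp (-((Δ - η₂) * x)) ^ (T - T₁) := pow_le_pow_left₀ (hy0 _) h1 _
      _ = Real.exp (-((d + 3 * η₂) * (((T - T₁ : ℕ) : ℝ) * x))) := by rw [← Real.exp_nat_mul, hΔeq]; congr 1; ring
      _ ≤ Real.exp (-((d + 3 * η₂) * (s - 3 / 2))) := Real.exp_le_exp.mpr (by linarith only [h2])
      _ = A * E := by rw [hAdef, hEdef, ← Real.exp_add]; congr 1; ring
  have hsmall : (1 - ρ ^ T) * ∑ j ∈ Finset.range k, y j ^ T ≤ ε := by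
    have hcard : ∑ j ∈ Finset.range k, y j ^ T ≤ k := by
      calc ∑ j ∈ Finset.range k, y j ^ T ≤ ∑ j ∈ Finset.range k, (1 : ℝ) :=
            Finset.sum_le_sum fun j _ => pow_le_one₀ (hy0 j) (hy1 j)
        _ = k := by simp
    have hρT : 1 - ρ ^ T ≤ (C1 * l + η) * ((T : ℝ) * x) := by
      have e : ρ ^ T = Real.exp (-((C1 * l + η) * ((T : ℝ) * x))) := by
        rw [hρdef, ← Real.exp_nat_mul]; congr 1; ring
      rw [e]; exact one_sub_exp_neg_le _
    have hCl : C1 * l ≤ η := by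
      have h3 : 2 * C1 / (2 * C1 + 1) ≤ 1 := by rw [div_le_one h2C1]; linarith only [hC10]
      calc C1 * l ≤ C1 * (2 * (η / (2 * C1 + 1))) := mul_le_mul_of_nonneg_left (by linarith only [hlam2, hlamη]) hC10
        _ = η * (2 * C1 / (2 * C1 + 1)) := by ring
        _ ≤ η * 1 := mul_le_mul_of_nonneg_left h3 hη.le
        _ = η := mul_one η
    have h1ρ : 0 ≤ 1 - ρ ^ T := by
      have := pow_le_one₀ hρpos.le hρ1 (n := T); linarith only [this]
    have h2η : C1 * l + η ≤ 2 * η := by linarith only [hCl]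
    calc (1 - ρ ^ T) * ∑ j ∈ Finset.range k, y j ^ T ≤ ((C1 * l + η) * ((T : ℝ) * x)) * k :=
          mul_le_mul hρT hcard (Finset.sum_nonneg fun j _ => pow_nonneg (hy0 j) T) (by positivity)
      _ ≤ (2 * η * (s + 1)) * k := by
          apply mul_le_mul_of_nonneg_right _ (Nat.cast_nonneg k)
          exact mul_le_mul h2η hτ1 (by positivity) (by positivity)
      _ = ε * (k / ((k : ℝ) + 1)) := by rw [hηdef]; field_simp
      _ ≤ ε * 1 := by
          apply mul_le_mul_of_nonneg_left _ hε.le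
          rw [div_le_one (by positivity)]; linarith only []
      _ = ε := mul_one ε
  -- (4) assembly: `x_k^T ≤ 3ε = e^{−d(s+1)} ≤ (e^{−dx})^T`
  have hzk : z k ^ T ≤ Real.exp (-(d * x)) ^ T := by
    have h0 := calc ρ ^ T * ∑ j ∈ Finset.range k, y j ^ T + z k ^ T ≤ ∑' j, z j ^ T := hxlow.trans hfin_z
        _ ≤ ∑' i, y i ^ T + ε := hUTL'
        _ = (∑ i ∈ Finset.range k, y i ^ T + y k ^ T) + ∑ i ∈ Finset.Ico (k + 1) N, y i ^ T + ∑' i, y (i + N) ^ T + ε := by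
            rw [hsplit_y, hsplit_y2]
    have h1 : z k ^ T ≤ (1 - ρ ^ T) * ∑ j ∈ Finset.range k, y j ^ T + y k ^ T +
        ((N : ℝ) - (k + 1)) * y (k + 1) ^ (T - T₁) + y (k + 1) ^ (T - T₁) + ε := by
      linarith only [h0, hmid, htail]
    have h4' : ((N : ℝ) - k) * y (k + 1) ^ (T - T₁) ≤ ((N : ℝ) - k) * (A * E) := mul_le_mul_of_nonneg_left hyk1 hNk0
    have h2 : y k ^ T + ((N : ℝ) - (k + 1)) * y (k + 1) ^ (T - T₁) + y (k + 1) ^ (T - T₁) ≤ M * E := by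
      have e : M * E = E + ((N : ℝ) - k) * (A * E) := by rw [hMdef]; ring
      rw [e]; linarith only [h4', hyk]
    have h3 : M * E ≤ ε := by
      have e : E = Real.exp (-(3 * η₂ * s)) * Real.exp (-(d * s)) := by
        rw [hEdef, ← Real.exp_add]; congr 1; ring
      rw [e, ← mul_assoc, hεdef]
      exact mul_le_mul_of_nonneg_right hsM (Real.exp_pos _).le
    have h4 : z k ^ T ≤ 3 * ε := by linarith only [h1, hsmall, h2, h3]
    have h5 : 3 * ε = Real.exp (-(d * (s + 1))) := by
      rw [hεdef, show -(d * (s + 1)) = -d + -(d * s) by ring, Real.exp_add]; ring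
    have h6' : d * ((T : ℝ) * x) ≤ d * (s + 1) := mul_le_mul_of_nonneg_left hτ1 hd0.le
    have h6 : Real.exp (-(d * (s + 1))) ≤ Real.exp (-(d * ((T : ℝ) * x))) :=
      Real.exp_le_exp.mpr (by linarith only [h6'])
    have h7 : Real.exp (-(d * ((T : ℝ) * x))) = Real.exp (-(d * x)) ^ T := by
      rw [← Real.exp_nat_mul]; congr 1; ring
    exact h4.trans (h5.le.trans (h6.trans h7.le))
  have hzk' : z k ≤ Real.exp (-(d * x)) := (pow_le_pow_iff_left₀ (hz0 k) (Real.exp_pos _).le hTpos.ne').mp hzk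
  -- (5) back to the statement
  have e_goal : -(d * l) / (L : ℝ) = -(d * x) := by rw [hxdef]; ring
  rw [e_goal]
  have hfin : levelValue su2Rep L β k / levelValue su2Rep L β 0 ≤ Real.exp (-(d * x)) := hzk'
  rwa [div_le_iff₀ hl0] at hfin

/-! ## §3 Conclusion: `UpperTraceLaw ∧ DressedRitz ⟹ RED` BY NAME (children `TraceFormula`, `OneSiteTail` CLOSED in the tree; KT composition landed) -/

/-- The sandwich with the CLOSED child `OneSiteTail` (stmt-QuantumFields-20204, `OST.oneSiteTail_proof`, p516856) discharged by name. -/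
theorem coarseNoIntruder_of_upperTraceLaw' (hU : UpperTraceLaw) (hDR : DressedRitz) : CoarseNoIntruder :=
  coarseNoIntruder_of_upperTraceLaw hU OST.oneSiteTail_proof hDR

/-- ★★ **ONE-SIDED TT DOOR.**  `UpperTraceLaw → DressedRitz → Theses.LuscherReduction.RunningReduction` — the crux RED (stmt-QuantumFields-19978) BY NAME
from the ONE-SIDED trace law and the route child `DressedRitz` (stmt-QuantumFields-20205) alone: the sandwich (§2) feeds the landed KT composition
`TraceDoor.runningReduction_of_coarseNoIntruder` (`Theorems/LuscherReductionTraceDoorKT.lean`).  Compare the route's glue item `TraceDoorGlue`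
(stmt-QuantumFields-20206): `TraceFormula → TwistedTraceScaling → OneSiteTail → DressedRitz → RunningReduction` — the two-sided dyadic law
`TwistedTraceScaling` (XL, stmt-QuantumFields-20203) is replaced by its upper half at a single femto-time. -/
theorem runningReduction_of_upperTraceLaw (hU : UpperTraceLaw) (hDR : DressedRitz) :
    Summit.QuantumFields.YangMills.Theses.LuscherReduction.RunningReduction :=
  TraceDoor.runningReduction_of_coarseNoIntruder (coarseNoIntruder_of_upperTraceLaw' hU hDR) hDR

/-! ## §4 Certificates: the restatement loses nothing — `TwistedTraceScaling ∧ OneSiteTail ⟹ FemtoWeyl` and `CoarseLevels ∧ FemtoWeyl ⟹ UpperTraceLaw`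

Together with the trace inversion INV (skeleton «KTR» PART 6, tree-pending `TraceDoorInv*`: `TraceFormula → TwistedTraceScaling → OneSiteTail → CoarseLevels`)
these show `TwistedTraceScaling ⟹ UpperTraceLaw` modulo the closed children, i.e. the one-sided law is implied by what the route already asks of child 20203. -/

/-- In the window, `lam ≤ 1/8` and `lam ≤ 1/(4B*)` put the one-site coupling beyond the threshold `B*`. -/
theorem oneSiteCoupling_ge_of_small {lam β Bs : ℝ} {L : ℕ} [NeZero L] (hlam : 0 < lam) (hW : InFemtoWindow lam β L)
    (hBs : 0 < Bs) (hlam8 : lam ≤ 1 / 8) (hlamB : lam ≤ 1 / (4 * Bs)) : Bs ≤ oneSiteCoupling β L := by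
  have hB14 : 1 / (4 * lam ^ 3) ≤ oneSiteCoupling β L := oneSiteCoupling_ge_of_window hlam hW
  have hlam1 : lam ≤ 1 := by linarith only [hlam8]
  have h3 : lam ^ 3 ≤ lam := by
    have := pow_le_pow_of_le_one hlam.le hlam1 (show 1 ≤ 3 by norm_num)
    rwa [pow_one] at this
  have h4 : lam * (4 * Bs) ≤ 1 := by rwa [le_div_iff₀ (by positivity)] at hlamB
  have h5 : Bs ≤ 1 / (4 * lam ^ 3) := by
    rw [le_div_iff₀ (by positivity)]
    calc Bs * (4 * lam ^ 3) = (4 * Bs) * lam ^ 3 := by ring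
      _ ≤ (4 * Bs) * lam := mul_le_mul_of_nonneg_left h3 (by positivity)
      _ = lam * (4 * Bs) := by ring
      _ ≤ 1 := h4
  exact h5.trans hB14

/-- The UPPER half of `CoarseLevels`, uniformly over the levels `j ≤ J` (finite intersection of eventual statements). -/
theorem coarseUpper_uniform (hCL : CoarseLevels) {η : ℝ} (hη : 0 < η) : ∀ J : ℕ, ∃ lam0 : ℝ, 0 < lam0 ∧ ∀ lam : ℝ, 0 < lam → lam ≤ lam0 →
    ∃ L0 : ℕ, ∀ (L : ℕ) [NeZero L], L0 ≤ L → ∀ β : ℝ, InFemtoWindow lam β L →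
      ∀ j : ℕ, j ≤ J → levelValue su2Rep L β j ≤ Real.exp (-((levelGap j - η) * luscherLambda β L) / L) * levelValue su2Rep L β 0 := by
  intro J
  induction J with
  | zero =>
    obtain ⟨lam0, hlam0, h⟩ := hCL 0 η hη
    refine ⟨lam0, hlam0, fun lam hlam hle => ?_⟩
    obtain ⟨L0, hL0⟩ := h lam hlam hle
    refine ⟨L0, fun L _ hL β hW j hj => ?_⟩
    obtain rfl : j = 0 := Nat.le_zero.mp hj
    exact (hL0 L hL β hW).2
  | succ J ih =>
    obtain ⟨lamA, hlamA, hA⟩ := ih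
    obtain ⟨lamB, hlamB, hB⟩ := hCL (J + 1) η hη
    refine ⟨min lamA lamB, lt_min hlamA hlamB, fun lam hlam hle => ?_⟩
    obtain ⟨LA, hLA⟩ := hA lam hlam (hle.trans (min_le_left _ _))
    obtain ⟨LB, hLB⟩ := hB lam hlam (hle.trans (min_le_right _ _))
    refine ⟨max LA LB, fun L _ hL β hW j hj => ?_⟩
    rcases hj.lt_or_eq with hlt | heq
    · exact hLA L ((le_max_left _ _).trans hL) β hW j (Nat.lt_succ_iff.mp hlt)
    · subst heq; exact (hLB L ((le_max_right _ _).trans hL) β hW).2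

set_option maxHeartbeats 1600000 in
/-- ★ (W1) `TwistedTraceScaling ∧ OneSiteTail ⟹ FemtoWeyl`: at femto-time `s₀` the one-site heat trace is `≤ (K+1)μ₀^T` (OneSiteTail) and `≥ μ₀^{2T}` at `2T`,
so the one-site dyadic ratio is `≥ 1/(K+1)²`; TTS with `ε = 1/(2(K+1)²)` transfers half of it to the full torus, and `physTrace(2T) ≤ λ₀^T·physTrace(T)`
turns `r_L(T) ≥ c` into `physTrace(T) ≤ λ₀^T/c`. -/
theorem femtoWeyl_of_twistedTraceScaling (hTTS : TwistedTraceScaling) (hOST : OneSiteTail) : FemtoWeyl := by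
  intro s0 hs0
  obtain ⟨K, B0, hK⟩ := hOST s0 hs0 1 one_pos
  set Bs : ℝ := max B0 1 with hBsdef
  have hBs1 : 1 ≤ Bs := le_max_right _ _
  have hBspos : 0 < Bs := one_pos.trans_le hBs1
  have hKpos : 0 < (K : ℝ) + 1 := by positivity
  set c : ℝ := 1 / (2 * ((K : ℝ) + 1) ^ 2) with hcdef
  have hc : 0 < c := by positivity
  obtain ⟨lamT, hlamT, hTT⟩ := hTTS s0 hs0 c hc
  have hq : 0 < min (s0 / 4) (min (1 / 8) (1 / (4 * Bs))) := lt_min (by positivity) (lt_min (by norm_num) (by positivity))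
  refine ⟨1 / c, min lamT (min (s0 / 4) (min (1 / 8) (1 / (4 * Bs)))), lt_min hlamT hq, fun lam hlam hlamle => ?_⟩
  have hlamT' : lam ≤ lamT := hlamle.trans (min_le_left _ _)
  have hlams : lam ≤ s0 / 4 := hlamle.trans ((min_le_right _ _).trans (min_le_left _ _))
  have hlam8 : lam ≤ 1 / 8 := hlamle.trans ((min_le_right _ _).trans ((min_le_right _ _).trans (min_le_left _ _)))
  have hlamB : lam ≤ 1 / (4 * Bs) := hlamle.trans ((min_le_right _ _).trans ((min_le_right _ _).trans (min_le_right _ _)))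
  obtain ⟨L0, hL0⟩ := hTT lam hlam hlamT'
  refine ⟨L0, fun L _ hL β hW => ?_⟩
  have htts := hL0 L hL β hW
  have hBge : Bs ≤ oneSiteCoupling β L := oneSiteCoupling_ge_of_small hlam hW hBspos hlam8 hlamB
  obtain ⟨hβ, hlamle', hlam2⟩ := hW
  -- scales
  set l : ℝ := luscherLambda β L with hldef
  have hlpos : 0 < l := hlam.trans_le hlamle'
  have hLpos : (0 : ℝ) < L := Nat.cast_pos.mpr (NeZero.pos L)
  have hL1 : (1 : ℝ) ≤ L := by exact_mod_cast NeZero.one_le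
  set x : ℝ := l / L with hxdef
  have hxpos : 0 < x := div_pos hlpos hLpos
  have hxl : x ≤ l := div_le_self hlpos.le hL1
  have hx2 : x ≤ s0 / 2 := by linarith only [hxl, hlam2, hlams]
  set B : ℝ := oneSiteCoupling β L with hBdef
  have hB0' : B0 ≤ B := (le_max_left _ _).trans hBge
  have hB1 : 1 ≤ B := hBs1.trans hBge
  have hbl : bareLambda B = x := by rw [hBdef, hxdef, hldef]; exact bareLambda_oneSiteCoupling hlpos
  have hmu0 : 0 < levelValue su2Rep 1 B 0 := levelValue_zero_su2Rep_pos 1 B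
  have hl0 : 0 < levelValue su2Rep L β 0 := levelValue_zero_su2Rep_pos L β
  -- time
  set T : ℕ := femtoSteps s0 β L with hTdef
  obtain ⟨hτlo0, -⟩ := femtoSteps_mul_bounds (s := s0) (β := β) (L := L) hs0.le hlpos
  have hτlo : s0 ≤ (T : ℝ) * x := hτlo0
  have hT2r : (2 : ℝ) ≤ T := by
    have h1 : 2 * x ≤ (T : ℝ) * x := by linarith only [hx2, hτlo]
    exact le_of_mul_le_mul_right h1 hxpos
  have hT2 : 2 ≤ T := by exact_mod_cast hT2r
  have h2T2 : 2 ≤ 2 * T := by omega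
  -- level currency on both lattices at `T` and `2T`
  set y : ℕ → ℝ := xval 1 B with hydef
  set z : ℕ → ℝ := xval L β with hzdef
  have hy0 : ∀ i, 0 ≤ y i := fun i => xval_nonneg hB1 i
  have hy1 : ∀ i, y i ≤ 1 := fun i => xval_le_one hB1 i
  have hz0 : ∀ j, 0 ≤ z j := fun j => xval_nonneg hβ j
  have hz1 : ∀ j, z j ≤ 1 := fun j => xval_le_one hβ j
  have hHS := hasSum_xval_pow (L := L) (β := β) hβ hT2
  have hHS2 := hasSum_xval_pow (L := L) (β := β) hβ h2T2
  have hHS1 := hasSum_xval_pow (L := 1) (β := B) hB1 hT2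
  have hHS12 := hasSum_xval_pow (L := 1) (β := B) hB1 h2T2
  set P1 : ℝ := physTrace L β T with hP1def
  set P2 : ℝ := physTrace L β (2 * T) with hP2def
  set Q1 : ℝ := physTrace 1 B T with hQ1def
  set Q2 : ℝ := physTrace 1 B (2 * T) with hQ2def
  have hl0T : 0 < levelValue su2Rep L β 0 ^ T := pow_pos hl0 T
  have hmu0T : 0 < levelValue su2Rep 1 B 0 ^ T := pow_pos hmu0 T
  -- (a) `P1 ≥ λ₀^T`
  have hz0one : z 0 = 1 := by show levelValue su2Rep L β 0 / levelValue su2Rep L β 0 = 1; exact div_self hl0.ne'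
  have hy0one : y 0 = 1 := by show levelValue su2Rep 1 B 0 / levelValue su2Rep 1 B 0 = 1; exact div_self hmu0.ne'
  have hA1 : 1 ≤ P1 / levelValue su2Rep L β 0 ^ T := by
    have := le_hasSum hHS 0 (fun j _ => pow_nonneg (hz0 j) T)
    have e : xval L β 0 ^ T = 1 := by show z 0 ^ T = 1; rw [hz0one, one_pow]
    rwa [e] at this
  have hP1pos : 0 < P1 := by
    have : levelValue su2Rep L β 0 ^ T ≤ P1 := by rwa [le_div_iff₀ hl0T, one_mul] at hA1
    exact hl0T.trans_le this
  -- (b) `P2 ≤ λ₀^T · P1`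
  have hP2le : P2 ≤ levelValue su2Rep L β 0 ^ T * P1 := by
    have hterm : ∀ j, z j ^ (2 * T) ≤ z j ^ T := fun j => pow_le_pow_of_le_one (hz0 j) (hz1 j) (by omega)
    have h1 : ∑' j, z j ^ (2 * T) ≤ ∑' j, z j ^ T := hHS2.summable.tsum_le_tsum hterm hHS.summable
    have h2 : P2 / levelValue su2Rep L β 0 ^ (2 * T) ≤ P1 / levelValue su2Rep L β 0 ^ T := by
      have e2 : ∑' j, z j ^ (2 * T) = P2 / levelValue su2Rep L β 0 ^ (2 * T) := hHS2.tsum_eq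
      have e1 : ∑' j, z j ^ T = P1 / levelValue su2Rep L β 0 ^ T := hHS.tsum_eq
      rw [← e1, ← e2]; exact h1
    have e3 : levelValue su2Rep L β 0 ^ (2 * T) = levelValue su2Rep L β 0 ^ T * levelValue su2Rep L β 0 ^ T := by rw [two_mul, pow_add]
    rw [e3, div_le_iff₀ (mul_pos hl0T hl0T)] at h2
    calc P2 ≤ P1 / levelValue su2Rep L β 0 ^ T * (levelValue su2Rep L β 0 ^ T * levelValue su2Rep L β 0 ^ T) := h2
      _ = levelValue su2Rep L β 0 ^ T * P1 := by field_simp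
  -- (c) `Q1 ≤ (K+1) μ₀^T`
  have hsum1 : Summable (fun i => y i ^ T) := hHS1.summable
  have hadm : s0 ≤ 2 * ((T : ℝ) * bareLambda B) := by rw [hbl]; linarith only [hτlo, hs0]
  obtain ⟨-, htail1⟩ := hK B hB0' T hadm
  have htail1' : ∑' i, y (i + K) ^ T ≤ 1 := htail1
  have hQ1le : Q1 ≤ ((K : ℝ) + 1) * levelValue su2Rep 1 B 0 ^ T := by
    have h1 : ∑' i, y i ^ T ≤ (K : ℝ) + 1 := by
      rw [← hsum1.sum_add_tsum_nat_add K]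
      have hhead : ∑ i ∈ Finset.range K, y i ^ T ≤ K := by
        calc ∑ i ∈ Finset.range K, y i ^ T ≤ ∑ i ∈ Finset.range K, (1 : ℝ) := Finset.sum_le_sum fun i _ => pow_le_one₀ (hy0 i) (hy1 i)
          _ = K := by simp
      linarith only [hhead, htail1']
    have e1 : ∑' i, y i ^ T = Q1 / levelValue su2Rep 1 B 0 ^ T := hHS1.tsum_eq
    rw [e1, div_le_iff₀ hmu0T] at h1
    exact h1
  have hQ1pos : 0 < Q1 := by
    have h := le_hasSum hHS1 0 (fun j _ => pow_nonneg (hy0 j) T)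
    have e : xval 1 B 0 ^ T = 1 := by show y 0 ^ T = 1; rw [hy0one, one_pow]
    rw [e] at h
    have e1 : Q1 / levelValue su2Rep 1 B 0 ^ T = ∑' i, xval 1 B i ^ T := hHS1.tsum_eq.symm
    have : levelValue su2Rep 1 B 0 ^ T ≤ Q1 := by
      have h' : (1 : ℝ) ≤ Q1 / levelValue su2Rep 1 B 0 ^ T := h
      rwa [le_div_iff₀ hmu0T, one_mul] at h'
    exact hmu0T.trans_le this
  -- (d) `Q2 ≥ μ₀^{2T}`
  have hQ2ge : levelValue su2Rep 1 B 0 ^ (2 * T) ≤ Q2 := by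
    have h := le_hasSum hHS12 0 (fun j _ => pow_nonneg (hy0 j) (2 * T))
    have e : xval 1 B 0 ^ (2 * T) = 1 := by show y 0 ^ (2 * T) = 1; rw [hy0one, one_pow]
    rw [e] at h
    have h' : (1 : ℝ) ≤ Q2 / levelValue su2Rep 1 B 0 ^ (2 * T) := h
    rwa [le_div_iff₀ (pow_pos hmu0 _), one_mul] at h'
  -- (e) the one-site dyadic ratio is `≥ 2c`
  have hr1 : 2 * c ≤ Q2 / Q1 ^ 2 := by
    rw [le_div_iff₀ (pow_pos hQ1pos 2)]
    have h1 : Q1 ^ 2 ≤ (((K : ℝ) + 1) * levelValue su2Rep 1 B 0 ^ T) ^ 2 := pow_le_pow_left₀ hQ1pos.le hQ1le 2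
    have e : (((K : ℝ) + 1) * levelValue su2Rep 1 B 0 ^ T) ^ 2 = ((K : ℝ) + 1) ^ 2 * levelValue su2Rep 1 B 0 ^ (2 * T) := by
      rw [mul_pow, ← pow_mul, mul_comm T 2]
    have e2 : 2 * c * (((K : ℝ) + 1) ^ 2 * levelValue su2Rep 1 B 0 ^ (2 * T)) = levelValue su2Rep 1 B 0 ^ (2 * T) := by
      rw [hcdef]; field_simp
    calc 2 * c * Q1 ^ 2 ≤ 2 * c * (((K : ℝ) + 1) ^ 2 * levelValue su2Rep 1 B 0 ^ (2 * T)) := by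
          rw [← e]; exact mul_le_mul_of_nonneg_left h1 (by positivity)
      _ = levelValue su2Rep 1 B 0 ^ (2 * T) := e2
      _ ≤ Q2 := hQ2ge
  -- (f) TTS transfers: `P2/P1² ≥ c`
  have hrL : c ≤ P2 / P1 ^ 2 := by
    have h := (abs_sub_le_iff.1 htts).2
    have h' : Q2 / Q1 ^ 2 - P2 / P1 ^ 2 ≤ c := h
    linarith only [h', hr1]
  -- (g) conclusion `P1 ≤ λ₀^T / c`
  have h1 : c * P1 ^ 2 ≤ levelValue su2Rep L β 0 ^ T * P1 := by
    rw [le_div_iff₀ (pow_pos hP1pos 2)] at hrL; exact hrL.trans hP2le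
  have h2 : c * P1 ≤ levelValue su2Rep L β 0 ^ T := by
    have h1' : c * P1 * P1 ≤ levelValue su2Rep L β 0 ^ T * P1 := by rw [mul_assoc, ← pow_two]; exact h1
    exact le_of_mul_le_mul_right h1' hP1pos
  show P1 ≤ 1 / c * levelValue su2Rep L β 0 ^ T
  rw [one_div, ← div_eq_inv_mul, le_div_iff₀ hc, mul_comm]
  exact h2

set_option maxHeartbeats 1600000 in
/-- ★ (W2) `CoarseLevels ∧ FemtoWeyl ⟹ UpperTraceLaw` (ONE closed, `TraceDoor.oneSiteLowerCoarse` by name; no `OneSiteTail` needed): given `(s, ε)`, Weyl at `s/2`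
gives `𝔷_L(T') ≤ C` at `T' = ⌈sL/2λ⌉`; a tail level `J` with `Δ_{J+1} ≥ 1 + (4/s)·log⁺(4C/ε)` (`levelGap → ∞`) makes
`Σ_{j>J} x_j^T ≤ x_{J+1}^{T−T'}𝔷_L(T') ≤ ε/4` (coarse upper law at `J+1`, `(T−T')x ≥ s/4` deep in the window), and on the head `j ≤ J` the coarse upper
`x_j ≤ e^{−(Δ_j−δ)x}` against the one-site lower `y_j ≥ e^{−(Δ_j+δ)x}` costs `≤ (J+1)·2δ(s+1) = ε/4`. -/
theorem upperTraceLaw_of_coarseLevels (hCL : CoarseLevels) (hWeyl : FemtoWeyl) : UpperTraceLaw := by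
  intro s hs ε hε
  -- Weyl at `s/2`
  obtain ⟨CW, lamW, hlamW, hWs⟩ := hWeyl (s / 2) (by positivity)
  set C1 : ℝ := max CW 1 with hC1def
  have hC11 : 1 ≤ C1 := le_max_right _ _
  have hC1pos : 0 < C1 := one_pos.trans_le hC11
  have hCW1 : CW ≤ C1 := le_max_left _ _
  -- the tail level `J`
  set G : ℝ := max 0 (Real.log (4 * C1 / ε)) with hGdef
  have hG0 : 0 ≤ G := le_max_left _ _
  obtain ⟨J, hJ⟩ : ∃ J : ℕ, 1 + 4 / s * G ≤ levelGap (J + 1) := by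
    obtain ⟨N, hN⟩ := (tendsto_atTop_atTop.1 OSTail.tendsto_levelGap_atTop) (1 + 4 / s * G)
    exact ⟨N, hN (N + 1) (by omega)⟩
  have hrate : 0 ≤ levelGap (J + 1) - 1 := by
    have : 0 ≤ 4 / s * G := by positivity
    linarith only [hJ, this]
  -- head precision `δ`
  set δ : ℝ := ε / (8 * ((J : ℝ) + 1) * (s + 1)) with hδdef
  have hden : 0 < 8 * ((J : ℝ) + 1) * (s + 1) := by positivity
  have hδ : 0 < δ := div_pos hε hden
  obtain ⟨lamA, hlamA, hA⟩ := coarseUpper_uniform hCL hδ J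
  obtain ⟨lamB, hlamB, hB⟩ := coarseUpper_uniform hCL one_pos (J + 1)
  obtain ⟨B0, hB0⟩ := oneSiteLowerCoarse J δ hδ
  set Bs : ℝ := max B0 1 with hBsdef
  have hBs1 : 1 ≤ Bs := le_max_right _ _
  have hBspos : 0 < Bs := one_pos.trans_le hBs1
  have hq : 0 < min (s / 8) (min (1 / 8) (1 / (4 * Bs))) := lt_min (by positivity) (lt_min (by norm_num) (by positivity))
  refine ⟨min (min lamW (min lamA lamB)) (min (s / 8) (min (1 / 8) (1 / (4 * Bs)))),
    lt_min (lt_min hlamW (lt_min hlamA hlamB)) hq, fun lam hlam hlamle => ?_⟩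
  have hlamW' : lam ≤ lamW := hlamle.trans ((min_le_left _ _).trans (min_le_left _ _))
  have hlamA' : lam ≤ lamA := hlamle.trans ((min_le_left _ _).trans ((min_le_right _ _).trans (min_le_left _ _)))
  have hlamB' : lam ≤ lamB := hlamle.trans ((min_le_left _ _).trans ((min_le_right _ _).trans (min_le_right _ _)))
  have hlams : lam ≤ s / 8 := hlamle.trans ((min_le_right _ _).trans (min_le_left _ _))
  have hlam8 : lam ≤ 1 / 8 := hlamle.trans ((min_le_right _ _).trans ((min_le_right _ _).trans (min_le_left _ _)))
  have hlamBs : lam ≤ 1 / (4 * Bs) := hlamle.trans ((min_le_right _ _).trans ((min_le_right _ _).trans (min_le_right _ _)))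
  obtain ⟨LW, hLW⟩ := hWs lam hlam hlamW'
  obtain ⟨LA, hLA⟩ := hA lam hlam hlamA'
  obtain ⟨LB, hLB⟩ := hB lam hlam hlamB'
  refine ⟨max (max LW (max LA LB)) ⌈8 * lam / s⌉₊, fun L _ hL β hW => ?_⟩
  have hLW' : LW ≤ L := ((le_max_left _ _).trans (le_max_left _ _)).trans hL
  have hLA' : LA ≤ L := (((le_max_left _ _).trans (le_max_right _ _)).trans (le_max_left _ _)).trans hL
  have hLB' : LB ≤ L := (((le_max_right _ _).trans (le_max_right _ _)).trans (le_max_left _ _)).trans hL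
  have hL8n : ⌈8 * lam / s⌉₊ ≤ L := (le_max_right _ _).trans hL
  have hL8 : 8 * lam / s ≤ (L : ℝ) := (Nat.le_ceil _).trans (by exact_mod_cast hL8n)
  -- the three eventual hypotheses at `(L, β)`
  have hweyl := hLW L hLW' β hW
  have hupJ := hLA L hLA' β hW
  have hupJ1 := hLB L hLB' β hW (J + 1) le_rfl
  have hBge : Bs ≤ oneSiteCoupling β L := oneSiteCoupling_ge_of_small hlam hW hBspos hlam8 hlamBs
  obtain ⟨hβ, hlamle', hlam2⟩ := hW
  -- scales
  set l : ℝ := luscherLambda β L with hldef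
  have hlpos : 0 < l := hlam.trans_le hlamle'
  have hLpos : (0 : ℝ) < L := Nat.cast_pos.mpr (NeZero.pos L)
  have hL1 : (1 : ℝ) ≤ L := by exact_mod_cast NeZero.one_le
  set x : ℝ := l / L with hxdef
  have hxpos : 0 < x := div_pos hlpos hLpos
  have hxl : x ≤ l := div_le_self hlpos.le hL1
  have hx1 : x ≤ 1 := by linarith only [hxl, hlam2, hlam8]
  have hx4 : x ≤ s / 4 := by
    rw [hxdef, div_le_iff₀ hLpos]
    have h1 : s / 4 * (8 * lam / s) ≤ s / 4 * (L : ℝ) := mul_le_mul_of_nonneg_left hL8 (by positivity)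
    have e : s / 4 * (8 * lam / s) = 2 * lam := by field_simp; ring
    linarith only [h1, e, hlam2]
  set B : ℝ := oneSiteCoupling β L with hBdef
  have hB0' : B0 ≤ B := (le_max_left _ _).trans hBge
  have hB1 : 1 ≤ B := hBs1.trans hBge
  have hbl : bareLambda B = x := by rw [hBdef, hxdef, hldef]; exact bareLambda_oneSiteCoupling hlpos
  have hmu0 : 0 < levelValue su2Rep 1 B 0 := levelValue_zero_su2Rep_pos 1 B
  have hl0 : 0 < levelValue su2Rep L β 0 := levelValue_zero_su2Rep_pos L β
  obtain ⟨-, hlowJ⟩ := hB0 B hB0'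
  -- times
  set T : ℕ := femtoSteps s β L with hTdef
  set T' : ℕ := femtoSteps (s / 2) β L with hT'def
  obtain ⟨hτlo0, hτhi0⟩ := femtoSteps_mul_bounds (s := s) (β := β) (L := L) hs.le hlpos
  obtain ⟨hτ'lo0, hτ'hi0⟩ := femtoSteps_mul_bounds (s := s / 2) (β := β) (L := L) (by positivity) hlpos
  have hτlo : s ≤ (T : ℝ) * x := hτlo0
  have hτhi : (T : ℝ) * x ≤ s + x := hτhi0
  have hτ'lo : s / 2 ≤ (T' : ℝ) * x := hτ'lo0
  have hτ'hi : (T' : ℝ) * x ≤ s / 2 + x := hτ'hi0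
  have hT'T : T' ≤ T := femtoSteps_mono (by linarith only [hs]) hlpos.le
  have hT'2r : (2 : ℝ) ≤ T' := by
    have h1 : 2 * x ≤ (T' : ℝ) * x := by linarith only [hx4, hτ'lo]
    exact le_of_mul_le_mul_right h1 hxpos
  have hT'2 : 2 ≤ T' := by exact_mod_cast hT'2r
  have hT2 : 2 ≤ T := hT'2.trans hT'T
  have hτ1 : (T : ℝ) * x ≤ s + 1 := by linarith only [hτhi, hx1]
  have hsub : (((T - T' : ℕ) : ℝ)) = (T : ℝ) - T' := Nat.cast_sub hT'T
  have hτdiff : s / 4 ≤ ((T - T' : ℕ) : ℝ) * x := by rw [hsub]; linarith only [hτlo, hτ'hi, hx4]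
  -- level currency
  set y : ℕ → ℝ := xval 1 B with hydef
  set z : ℕ → ℝ := xval L β with hzdef
  have hy0 : ∀ i, 0 ≤ y i := fun i => xval_nonneg hB1 i
  have hz0 : ∀ j, 0 ≤ z j := fun j => xval_nonneg hβ j
  have hz1 : ∀ j, z j ≤ 1 := fun j => xval_le_one hβ j
  have hzmono : ∀ {i j : ℕ}, i ≤ j → z j ≤ z i := fun hij => xval_le_xval hβ hij
  have hHS := hasSum_xval_pow (L := L) (β := β) hβ hT2
  have hHS' := hasSum_xval_pow (L := L) (β := β) hβ hT'2
  have hHS1 := hasSum_xval_pow (L := 1) (β := B) hB1 hT2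
  have hsumz : Summable (fun j => z j ^ T) := hHS.summable
  have hsumz' : Summable (fun j => z j ^ T') := hHS'.summable
  have hsumy : Summable (fun i => y i ^ T) := hHS1.summable
  have hl0T : 0 < levelValue su2Rep L β 0 ^ T := pow_pos hl0 T
  -- Weyl in level currency: `𝔷_L(T') ≤ C1`
  have hWeylz : ∑' j, z j ^ T' ≤ C1 := by
    have e : ∑' j, z j ^ T' = physTrace L β T' / levelValue su2Rep L β 0 ^ T' := hHS'.tsum_eq
    rw [e, div_le_iff₀ (pow_pos hl0 T')]
    exact hweyl.trans (mul_le_mul_of_nonneg_right hCW1 (pow_nonneg hl0.le _))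
  -- head: `z_j^T ≤ y_j^T + 2δ(s+1)` for `j ≤ J`
  have hhead_term : ∀ j : ℕ, j ≤ J → z j ^ T ≤ y j ^ T + 2 * δ * (s + 1) := by
    intro j hj
    have hup : levelValue su2Rep L β j ≤ Real.exp (-((levelGap j - δ) * l) / L) * levelValue su2Rep L β 0 := hupJ j hj
    have hlow : Real.exp (-((levelGap j + δ) * bareLambda B)) * levelValue su2Rep 1 B 0 ≤ levelValue su2Rep 1 B j := hlowJ j hj
    have hzj : z j ≤ Real.exp (-((levelGap j - δ) * x)) := by
      show levelValue su2Rep L β j / levelValue su2Rep L β 0 ≤ _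
      rw [div_le_iff₀ hl0]
      have e : -((levelGap j - δ) * l) / (L : ℝ) = -((levelGap j - δ) * x) := by rw [hxdef]; ring
      rw [← e]; exact hup
    have hyj : Real.exp (-((levelGap j + δ) * x)) ≤ y j := by
      show _ ≤ levelValue su2Rep 1 B j / levelValue su2Rep 1 B 0
      rw [le_div_iff₀ hmu0, ← hbl]; exact hlow
    -- `e^{-2δ T x} z_j^T ≤ y_j^T`
    have h1 : Real.exp (-(2 * δ * x)) * z j ≤ y j := by
      calc Real.exp (-(2 * δ * x)) * z j ≤ Real.exp (-(2 * δ * x)) * Real.exp (-((levelGap j - δ) * x)) :=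
            mul_le_mul_of_nonneg_left hzj (Real.exp_pos _).le
        _ = Real.exp (-((levelGap j + δ) * x)) := by rw [← Real.exp_add]; congr 1; ring
        _ ≤ y j := hyj
    have h2 : Real.exp (-(2 * δ * ((T : ℝ) * x))) * z j ^ T ≤ y j ^ T := by
      have := pow_le_pow_left₀ (mul_nonneg (Real.exp_pos _).le (hz0 j)) h1 T
      rw [mul_pow, ← Real.exp_nat_mul] at this
      have e : (T : ℝ) * -(2 * δ * x) = -(2 * δ * ((T : ℝ) * x)) := by ring
      rwa [e] at this
    have h3 : 1 - Real.exp (-(2 * δ * ((T : ℝ) * x))) ≤ 2 * δ * ((T : ℝ) * x) := one_sub_exp_neg_le _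
    have h4 : (1 - Real.exp (-(2 * δ * ((T : ℝ) * x)))) * z j ^ T ≤ 2 * δ * (s + 1) := by
      have hzT1 : z j ^ T ≤ 1 := pow_le_one₀ (hz0 j) (hz1 j)
      have h5 : 2 * δ * ((T : ℝ) * x) ≤ 2 * δ * (s + 1) := mul_le_mul_of_nonneg_left hτ1 (by positivity)
      have h6 : 0 ≤ 1 - Real.exp (-(2 * δ * ((T : ℝ) * x))) := by
        have : Real.exp (-(2 * δ * ((T : ℝ) * x))) ≤ 1 := Real.exp_le_one_iff.mpr (by
          have : 0 ≤ 2 * δ * ((T : ℝ) * x) := by positivity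
          linarith only [this])
        linarith only [this]
      calc (1 - Real.exp (-(2 * δ * ((T : ℝ) * x)))) * z j ^ T ≤ (2 * δ * ((T : ℝ) * x)) * 1 :=
            mul_le_mul h3 hzT1 (pow_nonneg (hz0 j) T) (by positivity)
        _ ≤ 2 * δ * (s + 1) := by rw [mul_one]; exact h5
    nlinarith only [h2, h4]
  have hhead : ∑ j ∈ Finset.range (J + 1), z j ^ T ≤ ∑ j ∈ Finset.range (J + 1), y j ^ T + ε / 4 := by
    calc ∑ j ∈ Finset.range (J + 1), z j ^ T ≤ ∑ j ∈ Finset.range (J + 1), (y j ^ T + 2 * δ * (s + 1)) :=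
          Finset.sum_le_sum fun j hj => hhead_term j (Nat.lt_succ_iff.mp (Finset.mem_range.mp hj))
      _ = ∑ j ∈ Finset.range (J + 1), y j ^ T + ((J : ℝ) + 1) * (2 * δ * (s + 1)) := by
          rw [Finset.sum_add_distrib, Finset.sum_const, Finset.card_range, nsmul_eq_mul]; push_cast; ring
      _ = ∑ j ∈ Finset.range (J + 1), y j ^ T + ε / 4 := by rw [hδdef]; field_simp; ring
  -- tail: `Σ_{j ≥ J+1} z_j^T ≤ ε/4`
  have htail : ∑' j, z (j + (J + 1)) ^ T ≤ ε / 4 := by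
    have hsumN : Summable (fun j => z (j + (J + 1)) ^ T) := (summable_nat_add_iff (J + 1)).2 hsumz
    have hsumN' : Summable (fun j => z (j + (J + 1)) ^ T') := (summable_nat_add_iff (J + 1)).2 hsumz'
    have hshift : ∑' j, z (j + (J + 1)) ^ T' ≤ C1 := by
      have e := hsumz'.sum_add_tsum_nat_add (J + 1)
      have hh : 0 ≤ ∑ j ∈ Finset.range (J + 1), z j ^ T' := Finset.sum_nonneg fun j _ => pow_nonneg (hz0 j) T'
      linarith only [e, hh, hWeylz]
    have hzJ : z (J + 1) ≤ Real.exp (-((levelGap (J + 1) - 1) * x)) := by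
      show levelValue su2Rep L β (J + 1) / levelValue su2Rep L β 0 ≤ _
      rw [div_le_iff₀ hl0]
      have e : -((levelGap (J + 1) - 1) * l) / (L : ℝ) = -((levelGap (J + 1) - 1) * x) := by rw [hxdef]; ring
      rw [← e]; exact hupJ1
    have hpow : z (J + 1) ^ (T - T') ≤ ε / (4 * C1) := by
      have h1 : (levelGap (J + 1) - 1) * (s / 4) ≤ (levelGap (J + 1) - 1) * (((T - T' : ℕ) : ℝ) * x) :=
        mul_le_mul_of_nonneg_left hτdiff hrate
      have h2 : G ≤ (levelGap (J + 1) - 1) * (s / 4) := by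
        have e : 4 / s * G * (s / 4) = G := by field_simp
        have := mul_le_mul_of_nonneg_right hJ (show (0 : ℝ) ≤ s / 4 by positivity)
        linarith only [this, e]
      have hlogle : Real.log (4 * C1 / ε) ≤ G := le_max_right _ _
      calc z (J + 1) ^ (T - T') ≤ Real.exp (-((levelGap (J + 1) - 1) * x)) ^ (T - T') := pow_le_pow_left₀ (hz0 _) hzJ _
        _ = Real.exp (-((levelGap (J + 1) - 1) * (((T - T' : ℕ) : ℝ) * x))) := by rw [← Real.exp_nat_mul]; congr 1; ring
        _ ≤ Real.exp (-Real.log (4 * C1 / ε)) := Real.exp_le_exp.mpr (by linarith only [h1, h2, hlogle])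
        _ = ε / (4 * C1) := by rw [Real.exp_neg, Real.exp_log (by positivity)]; field_simp
    have hterm : ∀ j, z (j + (J + 1)) ^ T ≤ z (j + (J + 1)) ^ T' * z (J + 1) ^ (T - T') := by
      intro j
      have e : T' + (T - T') = T := Nat.add_sub_cancel' hT'T
      calc z (j + (J + 1)) ^ T = z (j + (J + 1)) ^ T' * z (j + (J + 1)) ^ (T - T') := by rw [← pow_add, e]
        _ ≤ z (j + (J + 1)) ^ T' * z (J + 1) ^ (T - T') :=
            mul_le_mul_of_nonneg_left (pow_le_pow_left₀ (hz0 _) (hzmono (by omega)) _) (pow_nonneg (hz0 _) _)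
    calc ∑' j, z (j + (J + 1)) ^ T ≤ ∑' j, z (j + (J + 1)) ^ T' * z (J + 1) ^ (T - T') := hsumN.tsum_le_tsum hterm (hsumN'.mul_right _)
      _ = (∑' j, z (j + (J + 1)) ^ T') * z (J + 1) ^ (T - T') := tsum_mul_right
      _ ≤ C1 * (ε / (4 * C1)) := mul_le_mul hshift hpow (pow_nonneg (hz0 _) _) hC1pos.le
      _ = ε / 4 := by field_simp
  -- total in level currency
  have hmain : ∑' j, z j ^ T ≤ ∑' i, y i ^ T + ε := by
    have e := (hsumz.sum_add_tsum_nat_add (J + 1)).symm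
    have hy_head : ∑ j ∈ Finset.range (J + 1), y j ^ T ≤ ∑' i, y i ^ T :=
      hsumy.sum_le_tsum (Finset.range (J + 1)) (fun j _ => pow_nonneg (hy0 j) T)
    rw [e]; linarith only [hhead, htail, hy_head, hε]
  -- back to traces
  have e1 : ∑' j, z j ^ T = physTrace L β T / levelValue su2Rep L β 0 ^ T := hHS.tsum_eq
  have e2 : ∑' i, y i ^ T = physTrace 1 B T / levelValue su2Rep 1 B 0 ^ T := hHS1.tsum_eq
  rw [e1, e2, div_le_iff₀ hl0T] at hmain
  exact hmain

/-- (W1)+(W2) with the closed child plugged in: `CoarseLevels → TwistedTraceScaling → UpperTraceLaw` — so along the TT door (INV: TTS ⟹ CoarseLevels)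
the two-sided child implies the one-sided law; the restatement `TwistedTraceScaling ↦ UpperTraceLaw` of child 20203 loses nothing the route uses. -/
theorem upperTraceLaw_of_twistedTraceScaling (hCL : CoarseLevels) (hTTS : TwistedTraceScaling) : UpperTraceLaw :=
  upperTraceLaw_of_coarseLevels hCL (femtoWeyl_of_twistedTraceScaling hTTS OST.oneSiteTail_proof)

/-! ## §5 (GEN 8) INV is LANDED ⇒ `TwistedTraceScaling ⟹ UpperTraceLaw` UNCONDITIONALLY

The trace inversion INV is now a tree theorem: `TraceDoor.coarseLevels_of_twistedTraceScaling : TwistedTraceScaling → ⟨CoarseLevels text⟩`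
(`Theorems/LuscherReductionTraceDoorCorollary.lean`, ym-infvol-p1 g4, 2026-08-27; children `TraceFormula`, `OneSiteTail` closed).  Hence §4's
`upperTraceLaw_of_twistedTraceScaling : CoarseLevels → TwistedTraceScaling → UpperTraceLaw` loses its first hypothesis. -/

/-- `CoarseLevels` (this file's verbatim copy of the TT text) from the child `TwistedTraceScaling` alone — the landed INV by name. -/
theorem coarseLevels_of_twistedTraceScaling' (hTTS : TwistedTraceScaling) : CoarseLevels :=
  TraceDoor.coarseLevels_of_twistedTraceScaling hTTS

/-- ★ (GEN 8) `TwistedTraceScaling ⟹ UpperTraceLaw` with NO side hypothesis: the one-sided law is a COROLLARY of child 20203 (INV landed, §4 (W1)+(W2)). -/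
theorem upperTraceLaw_of_twistedTraceScaling' (hTTS : TwistedTraceScaling) : UpperTraceLaw :=
  upperTraceLaw_of_twistedTraceScaling (coarseLevels_of_twistedTraceScaling' hTTS) hTTS

/-- (GEN 8) `TwistedTraceScaling ⟹ FemtoWeyl` unconditionally (child `OneSiteTail` closed). -/
theorem femtoWeyl_of_twistedTraceScaling' (hTTS : TwistedTraceScaling) : FemtoWeyl :=
  femtoWeyl_of_twistedTraceScaling hTTS OST.oneSiteTail_proof

/-! ## §6 (GEN 8) The converse: `UpperTraceLaw ∧ DressedRitz ⟹ TwistedTraceScaling` — the cuts `{TTS, DressedRitz}` and `{UTL, DressedRitz}` of RED coincide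

Given the sibling child `DressedRitz` (stmt-QuantumFields-20205), the one-sided law and the two-sided dyadic ratio law are EQUIVALENT
(`upperTraceLaw_iff_twistedTraceScaling`).  So the pivot `TwistedTraceScaling ↦ UpperTraceLaw` of child 20203 is strength-neutral for the
route: it changes the SHAPE of what a prover must show (one inequality, vacuum-normalised, monotone under adding spectral weight — comparison /
domination tools admissible), not the logical content of the cut.

Proof (level currency, `x = λ/L = λ_b(B)`, `T = ⌈sL/λ⌉`, `T₂ = ⌈2sL/λ⌉ ∈ {2T−1, 2T}`; `a = Σ_j z_j^T`, `b = Σ_j z_j^{2T}`, `a₁ = Σ_i y_i^T`, `b₁ = Σ_i y_i^{2T}`,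
so that `r_L = b/a²`, `r_1 = b₁/a₁²`):  UPPER `a ≤ a₁ + δ` (UTL at `s`); `b ≤ Σ z^{T₂} ≤ Σ y^{T₂} + δ` (antitone in `T`, UTL at `2s`) and the one-site
one-step robustness `Σ y^{T₂} ≤ b₁ + 2δ` (`y^{T₂} ≤ y^{2T} + (1−y)`, `1 − y_i ≤ (Δ_i+1)x` on the head `i < K` by ONE's coarse lower law, tail `≤ δ` by
`OneSiteTail`);  LOWER `a ≥ a₁ − 2δ`, `b ≥ b₁ − 2δ` (the jaw `z_j ≥ ρ y_j`, `j ≤ K`, `ρ = e^{−(C⁺λ+η)x}`, from `DressedRitz` (i),(iii) + `ritzBasicsR3` exactly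
as in §2, head `≤ K`, tail `≤ δ`);  `a, a₁ ≥ 1`, `0 ≤ b₁ ≤ a₁`;  and the pure-real rule `|b/a² − b₁/a₁²| ≤ |b − b₁| + 2|a − a₁| ≤ 7δ`, `δ = ε/8`. -/

/-- `y^m ≤ y^n + (1 − y)` for `0 ≤ y ≤ 1` and `n ≤ m + 1` (one-step robustness of Laplace weights). -/
theorem pow_le_pow_add_one_sub {y : ℝ} (h0 : 0 ≤ y) (h1 : y ≤ 1) {m n : ℕ} (hnm : n ≤ m + 1) : y ^ m ≤ y ^ n + (1 - y) := by
  have ha : y ^ (m + 1) ≤ y ^ n := pow_le_pow_of_le_one h0 h1 hnm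
  have hb : y ^ m ≤ 1 := pow_le_one₀ h0 h1
  have hc : y ^ m * (1 - y) ≤ 1 * (1 - y) := mul_le_mul_of_nonneg_right hb (sub_nonneg.2 h1)
  have e : y ^ m = y ^ (m + 1) + y ^ m * (1 - y) := by ring
  linarith

/-- `⌈2sL/λ⌉ ≤ 2⌈sL/λ⌉`. -/
theorem femtoSteps_two_mul_le (s β : ℝ) (L : ℕ) : femtoSteps (2 * s) β L ≤ 2 * femtoSteps s β L := by
  unfold femtoSteps
  refine Nat.ceil_le.mpr ?_
  push_cast
  have h := Nat.le_ceil (s * (L : ℝ) / luscherLambda β L)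
  have e : 2 * s * (L : ℝ) / luscherLambda β L = 2 * (s * (L : ℝ) / luscherLambda β L) := by ring
  rw [e]; linarith

/-- `2⌈sL/λ⌉ ≤ ⌈2sL/λ⌉ + 1` (`s ≥ 0`, `λ > 0`). -/
theorem two_mul_femtoSteps_le {s β : ℝ} {L : ℕ} (hs : 0 ≤ s) (hl : 0 < luscherLambda β L) :
    2 * femtoSteps s β L ≤ femtoSteps (2 * s) β L + 1 := by
  unfold femtoSteps
  have hu : 0 ≤ s * (L : ℝ) / luscherLambda β L := by positivity
  have h1 : (⌈s * (L : ℝ) / luscherLambda β L⌉₊ : ℝ) < s * (L : ℝ) / luscherLambda β L + 1 := Nat.ceil_lt_add_one hu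
  have h2 : 2 * s * (L : ℝ) / luscherLambda β L ≤ (⌈2 * s * (L : ℝ) / luscherLambda β L⌉₊ : ℝ) := Nat.le_ceil _
  have e : 2 * s * (L : ℝ) / luscherLambda β L = 2 * (s * (L : ℝ) / luscherLambda β L) := by ring
  have h3 : (2 : ℝ) * (⌈s * (L : ℝ) / luscherLambda β L⌉₊ : ℝ) < (⌈2 * s * (L : ℝ) / luscherLambda β L⌉₊ : ℝ) + 2 := by linarith
  have h4 : 2 * ⌈s * (L : ℝ) / luscherLambda β L⌉₊ < ⌈2 * s * (L : ℝ) / luscherLambda β L⌉₊ + 2 := by exact_mod_cast h3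
  omega

/-- The pure-real ratio rule: `|b/a² − b₁/a₁²| ≤ |b − b₁| + 2|a − a₁|` for `a, a₁ ≥ 1`, `0 ≤ b₁ ≤ a₁`. -/
theorem ratio_rule {a a₁ b b₁ : ℝ} (ha : 1 ≤ a) (ha₁ : 1 ≤ a₁) (hb₁ : 0 ≤ b₁) (hb₁a : b₁ ≤ a₁) :
    |b / a ^ 2 - b₁ / a₁ ^ 2| ≤ |b - b₁| + 2 * |a - a₁| := by
  have ha0 : 0 < a := by linarith
  have ha₁0 : 0 < a₁ := by linarith
  have ha2 : (1 : ℝ) ≤ a ^ 2 := by nlinarith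
  set w : ℝ := b₁ * (a₁ + a) / (a ^ 2 * a₁ ^ 2) with hwdef
  have e : b / a ^ 2 - b₁ / a₁ ^ 2 = (b - b₁) / a ^ 2 + (a₁ - a) * w := by
    rw [hwdef]; field_simp [ha0.ne', ha₁0.ne']; ring
  rw [e]
  have h1 : |(b - b₁) / a ^ 2| ≤ |b - b₁| := by
    rw [abs_div, abs_of_pos (by positivity : (0 : ℝ) < a ^ 2)]
    exact div_le_self (abs_nonneg _) ha2
  have hw0 : 0 ≤ w := by rw [hwdef]; positivity
  have hw2 : w ≤ 2 := by
    rw [hwdef, div_le_iff₀ (by positivity)]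
    have h3 : b₁ * (a₁ + a) ≤ a₁ * (a₁ + a) := mul_le_mul_of_nonneg_right hb₁a (by positivity)
    have h4 : a₁ ^ 2 ≤ a ^ 2 * a₁ ^ 2 := le_mul_of_one_le_left (sq_nonneg _) ha2
    have hp : 1 ≤ a * a₁ := by nlinarith
    have h5 : a₁ * a ≤ a ^ 2 * a₁ ^ 2 :=
      calc a₁ * a = 1 * (a * a₁) := by ring
        _ ≤ (a * a₁) * (a * a₁) := mul_le_mul_of_nonneg_right hp (by positivity)
        _ = a ^ 2 * a₁ ^ 2 := by ring
    nlinarith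
  have h2 : |(a₁ - a) * w| ≤ 2 * |a - a₁| := by
    rw [abs_mul, abs_of_nonneg hw0, abs_sub_comm]
    calc |a - a₁| * w ≤ |a - a₁| * 2 := mul_le_mul_of_nonneg_left hw2 (abs_nonneg _)
      _ = 2 * |a - a₁| := mul_comm _ _
  calc |(b - b₁) / a ^ 2 + (a₁ - a) * w| ≤ |(b - b₁) / a ^ 2| + |(a₁ - a) * w| := abs_add_le _ _
    _ ≤ |b - b₁| + 2 * |a - a₁| := add_le_add h1 h2

set_option maxHeartbeats 2400000 in
/-- ★★ (GEN 8) **The converse door.**  `UpperTraceLaw ∧ OneSiteTail ∧ DressedRitz ⟹ TwistedTraceScaling` (child 20203 BY NAME; `TraceFormula`, ONE, `ritzBasicsR3`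
closed / landed and used by name).  [cite: Luscher1983, §3] [cite: ReedSimonIV1978, Thm. XIII.1] -/
theorem twistedTraceScaling_of_upperTraceLaw (hU : UpperTraceLaw) (hOST : OneSiteTail) (hDR : DressedRitz) : TwistedTraceScaling := by
  intro s hs ε hε
  -- (1) constants fixed by `(s, ε)`: `δ`; OneSiteTail at `(s, δ)` gives `K, B0`; ONE's coarse lower law on `j ≤ K` gives `B0'`; `G`; `η`; UTL at `s`, `2s`; DressedRitz at `(K, η)`
  set δ : ℝ := ε / 8 with hδdef
  have hδ : 0 < δ := by rw [hδdef]; positivity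
  obtain ⟨K, B0, hK⟩ := hOST s hs δ hδ
  obtain ⟨B0', hB0'⟩ := oneSiteLowerCoarse K 1 one_pos
  set Bs : ℝ := max (max B0 B0') 1 with hBsdef
  have hBs1 : 1 ≤ Bs := le_max_right _ _
  have hBspos : 0 < Bs := one_pos.trans_le hBs1
  have hgapK : 0 ≤ levelGap K := levelGap_nonneg K
  set G : ℝ := (K : ℝ) * (levelGap K + 1) with hGdef
  have hG0 : 0 ≤ G := by rw [hGdef]; positivity
  have hG1 : 0 < 2 * (G + 1) := by positivity
  have hden : 0 < 4 * ((K : ℝ) + 1) * (s + 1) := by positivity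
  set η : ℝ := δ / (4 * ((K : ℝ) + 1) * (s + 1)) with hηdef
  have hη : 0 < η := div_pos hδ hden
  have hηden : η * (4 * ((K : ℝ) + 1) * (s + 1)) = δ := by rw [hηdef]; exact div_mul_cancel₀ _ hden.ne'
  obtain ⟨lamU1, hlamU1, hU1⟩ := hU s hs δ hδ
  obtain ⟨lamU2, hlamU2, hU2⟩ := hU (2 * s) (by positivity) δ hδ
  obtain ⟨C, lamR, hlamR, hR⟩ := hDR K η hη
  set C1 : ℝ := max C 0 with hC1def
  have hC10 : 0 ≤ C1 := le_max_right _ _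
  have hCC1 : C ≤ C1 := le_max_left _ _
  have h2C1 : 0 < 2 * C1 + 1 := by linarith only [hC10]
  have hq1 : 0 < η / (2 * C1 + 1) := div_pos hη h2C1
  have hq2 : 0 < 1 / (4 * Bs) := by positivity
  have hq3 : 0 < δ / (2 * (G + 1)) := div_pos hδ hG1
  have hq4 : 0 < s / 4 := by positivity
  refine ⟨min (min (min lamU1 lamU2) lamR) (min (min (s / 4) (1 / 8)) (min (1 / (4 * Bs)) (min (η / (2 * C1 + 1)) (δ / (2 * (G + 1)))))),
    lt_min (lt_min (lt_min hlamU1 hlamU2) hlamR) (lt_min (lt_min hq4 (by norm_num)) (lt_min hq2 (lt_min hq1 hq3))), fun lam hlam hlamle => ?_⟩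
  have hlamU1' : lam ≤ lamU1 := hlamle.trans ((min_le_left _ _).trans ((min_le_left _ _).trans (min_le_left _ _)))
  have hlamU2' : lam ≤ lamU2 := hlamle.trans ((min_le_left _ _).trans ((min_le_left _ _).trans (min_le_right _ _)))
  have hlamR' : lam ≤ lamR := hlamle.trans ((min_le_left _ _).trans (min_le_right _ _))
  have hlams : lam ≤ s / 4 := hlamle.trans ((min_le_right _ _).trans ((min_le_left _ _).trans (min_le_left _ _)))
  have hlam8 : lam ≤ 1 / 8 := hlamle.trans ((min_le_right _ _).trans ((min_le_left _ _).trans (min_le_right _ _)))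
  have hlamB : lam ≤ 1 / (4 * Bs) := hlamle.trans ((min_le_right _ _).trans ((min_le_right _ _).trans (min_le_left _ _)))
  have hlamη : lam ≤ η / (2 * C1 + 1) :=
    hlamle.trans ((min_le_right _ _).trans ((min_le_right _ _).trans ((min_le_right _ _).trans (min_le_left _ _))))
  have hlamG : lam ≤ δ / (2 * (G + 1)) :=
    hlamle.trans ((min_le_right _ _).trans ((min_le_right _ _).trans ((min_le_right _ _).trans (min_le_right _ _))))
  obtain ⟨LU1, hLU1⟩ := hU1 lam hlam hlamU1'
  obtain ⟨LU2, hLU2⟩ := hU2 lam hlam hlamU2'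
  obtain ⟨LR, hLR⟩ := hR lam hlam hlamR'
  refine ⟨max (max LU1 LU2) LR, fun L _ hL β hW => ?_⟩
  have hLU1' : LU1 ≤ L := ((le_max_left _ _).trans (le_max_left _ _)).trans hL
  have hLU2' : LU2 ≤ L := ((le_max_right _ _).trans (le_max_left _ _)).trans hL
  have hLR' : LR ≤ L := (le_max_right _ _).trans hL
  show |physTrace L β (2 * femtoSteps s β L) / physTrace L β (femtoSteps s β L) ^ 2 -
      physTrace 1 (oneSiteCoupling β L) (2 * femtoSteps s β L) / physTrace 1 (oneSiteCoupling β L) (femtoSteps s β L) ^ 2| ≤ ε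
  -- (2) the eventual hypotheses at this `(L, β)`
  have hUTL1 := hLU1 L hLU1' β hW
  have hUTL2 := hLU2 L hLU2' β hW
  obtain ⟨φ, hφphys, hφon, hφdiag, hφanti, hratio, -, hcap⟩ := hLR L hLR' β hW
  have hBge : Bs ≤ oneSiteCoupling β L := oneSiteCoupling_ge_of_small hlam hW hBspos hlam8 hlamB
  obtain ⟨hβ, hlamle', hlam2⟩ := hW
  -- scales
  set l : ℝ := luscherLambda β L with hldef
  have hlpos : 0 < l := hlam.trans_le hlamle'
  have hLpos : (0 : ℝ) < L := Nat.cast_pos.mpr (NeZero.pos L)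
  have hL1 : (1 : ℝ) ≤ L := by exact_mod_cast NeZero.one_le
  set x : ℝ := l / L with hxdef
  have hxpos : 0 < x := div_pos hlpos hLpos
  have hxl : x ≤ l := div_le_self hlpos.le hL1
  have hx1 : x ≤ 1 := by linarith only [hxl, hlam2, hlam8]
  have hx2 : x ≤ s / 2 := by linarith only [hxl, hlam2, hlams]
  have hlx : 0 < l * x := mul_pos hlpos hxpos
  set B : ℝ := oneSiteCoupling β L with hBdef
  have hB0B : B0 ≤ B := ((le_max_left _ _).trans (le_max_left _ _)).trans hBge
  have hB0'B : B0' ≤ B := ((le_max_right _ _).trans (le_max_left _ _)).trans hBge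
  have hB1 : 1 ≤ B := hBs1.trans hBge
  have hbl : bareLambda B = x := by rw [hBdef, hxdef, hldef]; exact bareLambda_oneSiteCoupling hlpos
  have hmu0 : 0 < levelValue su2Rep 1 B 0 := levelValue_zero_su2Rep_pos 1 B
  have hl0 : 0 < levelValue su2Rep L β 0 := levelValue_zero_su2Rep_pos L β
  have hmunn : ∀ i : ℕ, 0 ≤ levelValue su2Rep 1 B i := fun i => transferValuesNonneg 1 B i hB1
  -- times `T = ⌈sL/λ⌉ ≥ 2`, `T₂ = ⌈2sL/λ⌉ ∈ [T, 2T]`, `2T ≤ T₂ + 1`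
  set T : ℕ := femtoSteps s β L with hTdef
  set T₂ : ℕ := femtoSteps (2 * s) β L with hT₂def
  obtain ⟨hτlo0, hτhi0⟩ := femtoSteps_mul_bounds (s := s) (β := β) (L := L) hs.le hlpos
  have hτlo : s ≤ (T : ℝ) * x := hτlo0
  have hτhi : (T : ℝ) * x ≤ s + x := hτhi0
  obtain ⟨hτ₂lo0, -⟩ := femtoSteps_mul_bounds (s := 2 * s) (β := β) (L := L) (by positivity) hlpos
  have hτ₂lo : 2 * s ≤ (T₂ : ℝ) * x := hτ₂lo0
  have hT2r : (2 : ℝ) ≤ T := by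
    have h1 : 2 * x ≤ (T : ℝ) * x := by linarith only [hx2, hτlo]
    exact le_of_mul_le_mul_right h1 hxpos
  have hT2 : 2 ≤ T := by exact_mod_cast hT2r
  have hTT₂ : T ≤ T₂ := femtoSteps_mono (by linarith only [hs]) hlpos.le
  have hT₂2 : 2 ≤ T₂ := hT2.trans hTT₂
  have h2T2 : 2 ≤ 2 * T := by omega
  have hT₂le : T₂ ≤ 2 * T := femtoSteps_two_mul_le s β L
  have h2Tle : 2 * T ≤ T₂ + 1 := two_mul_femtoSteps_le hs.le hlpos
  have hτ1 : (T : ℝ) * x ≤ s + 1 := by linarith only [hτhi, hx1]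
  have hτ1' : (T : ℝ) * x ≤ 2 * (s + 1) := by linarith only [hτ1, hs]
  have h2τ : ((2 * T : ℕ) : ℝ) * x ≤ 2 * (s + 1) := by push_cast; linarith only [hτ1]
  -- normalised levels on both lattices
  set y : ℕ → ℝ := xval 1 B with hydef
  set z : ℕ → ℝ := xval L β with hzdef
  have hy0 : ∀ i, 0 ≤ y i := fun i => xval_nonneg hB1 i
  have hy1 : ∀ i, y i ≤ 1 := fun i => xval_le_one hB1 i
  have hz0 : ∀ j, 0 ≤ z j := fun j => xval_nonneg hβ j
  have hz1 : ∀ j, z j ≤ 1 := fun j => xval_le_one hβ j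
  have hy0one : y 0 = 1 := by show levelValue su2Rep 1 B 0 / levelValue su2Rep 1 B 0 = 1; exact div_self hmu0.ne'
  have hz0one : z 0 = 1 := by show levelValue su2Rep L β 0 / levelValue su2Rep L β 0 = 1; exact div_self hl0.ne'
  have hHS := hasSum_xval_pow (L := L) (β := β) hβ hT2
  have hHS2 := hasSum_xval_pow (L := L) (β := β) hβ h2T2
  have hHS₂ := hasSum_xval_pow (L := L) (β := β) hβ hT₂2
  have hHS1 := hasSum_xval_pow (L := 1) (β := B) hB1 hT2
  have hHS12 := hasSum_xval_pow (L := 1) (β := B) hB1 h2T2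
  have hHS1₂ := hasSum_xval_pow (L := 1) (β := B) hB1 hT₂2
  have hsumzT : Summable (fun j => z j ^ T) := hHS.summable
  have hsumz2T : Summable (fun j => z j ^ (2 * T)) := hHS2.summable
  have hsumzT₂ : Summable (fun j => z j ^ T₂) := hHS₂.summable
  have hsumyT : Summable (fun i => y i ^ T) := hHS1.summable
  have hsumy2T : Summable (fun i => y i ^ (2 * T)) := hHS12.summable
  have hsumyT₂ : Summable (fun i => y i ^ T₂) := hHS1₂.summable
  -- OneSiteTail at `T`, `2T`, `T₂` (admissible: `s ≤ 2·T'·x`)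
  have hadmT : s ≤ 2 * ((T : ℝ) * bareLambda B) := by rw [hbl]; linarith only [hτlo, hs]
  have hadm2T : s ≤ 2 * (((2 * T : ℕ) : ℝ) * bareLambda B) := by rw [hbl]; push_cast; nlinarith only [hτlo, hs, hxpos]
  have hadmT₂ : s ≤ 2 * ((T₂ : ℝ) * bareLambda B) := by rw [hbl]; linarith only [hτ₂lo, hs]
  obtain ⟨-, htailT⟩ := hK B hB0B T hadmT
  obtain ⟨-, htail2T⟩ := hK B hB0B (2 * T) hadm2T
  obtain ⟨-, htailT₂⟩ := hK B hB0B T₂ hadmT₂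
  have htailT' : ∑' i, y (i + K) ^ T ≤ δ := htailT
  have htail2T' : ∑' i, y (i + K) ^ (2 * T) ≤ δ := htail2T
  have htailT₂' : ∑' i, y (i + K) ^ T₂ ≤ δ := htailT₂
  -- the six Laplace sums
  set a : ℝ := ∑' j, z j ^ T with hadef
  set b : ℝ := ∑' j, z j ^ (2 * T) with hbdef
  set a₂ : ℝ := ∑' j, z j ^ T₂ with ha₂def
  set a₁ : ℝ := ∑' i, y i ^ T with ha₁def
  set b₁ : ℝ := ∑' i, y i ^ (2 * T) with hb₁def
  set c₂ : ℝ := ∑' i, y i ^ T₂ with hc₂def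
  -- (3) UPPER: UTL at `s` and `2s` in level currency, antitonicity, one-site robustness
  have hU1c : a ≤ a₁ + δ := by
    rw [hadef, ha₁def, hHS.tsum_eq, hHS1.tsum_eq, div_le_iff₀ (pow_pos hl0 T)]
    exact hUTL1
  have hU2c : a₂ ≤ c₂ + δ := by
    rw [ha₂def, hc₂def, hHS₂.tsum_eq, hHS1₂.tsum_eq, div_le_iff₀ (pow_pos hl0 T₂)]
    exact hUTL2
  have hA : b ≤ a₂ := by
    rw [hbdef, ha₂def]
    exact hsumz2T.tsum_le_tsum (fun j => pow_le_pow_of_le_one (hz0 j) (hz1 j) hT₂le) hsumzT₂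
  have hlow1 := (hB0' B hB0'B).2
  have hRob : c₂ ≤ b₁ + 2 * δ := by
    have hsplit : c₂ = ∑ i ∈ Finset.range K, y i ^ T₂ + ∑' i, y (i + K) ^ T₂ := by
      rw [hc₂def]; exact (hsumyT₂.sum_add_tsum_nat_add K).symm
    have hhead2T : ∑ i ∈ Finset.range K, y i ^ (2 * T) ≤ b₁ := by
      rw [hb₁def]; exact hsumy2T.sum_le_tsum (Finset.range K) (fun i _ => pow_nonneg (hy0 i) _)
    have hterm : ∀ i ∈ Finset.range K, y i ^ T₂ ≤ y i ^ (2 * T) + (levelGap K + 1) * x := by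
      intro i hi
      have hiK : i ≤ K := (Finset.mem_range.mp hi).le
      have h1 : y i ^ T₂ ≤ y i ^ (2 * T) + (1 - y i) := pow_le_pow_add_one_sub (hy0 i) (hy1 i) h2Tle
      have hlow : Real.exp (-((levelGap i + 1) * bareLambda B)) * levelValue su2Rep 1 B 0 ≤ levelValue su2Rep 1 B i := hlow1 i hiK
      have hyi : Real.exp (-((levelGap i + 1) * x)) ≤ y i := by
        show _ ≤ levelValue su2Rep 1 B i / levelValue su2Rep 1 B 0
        rw [le_div_iff₀ hmu0, ← hbl]; exact hlow
      have h2 : 1 - y i ≤ (levelGap i + 1) * x := by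
        have := one_sub_exp_neg_le ((levelGap i + 1) * x); linarith only [this, hyi]
      have h3 : (levelGap i + 1) * x ≤ (levelGap K + 1) * x :=
        mul_le_mul_of_nonneg_right (by linarith only [levelGap_mono hiK]) hxpos.le
      linarith only [h1, h2, h3]
    have hhead : ∑ i ∈ Finset.range K, y i ^ T₂ ≤ ∑ i ∈ Finset.range K, y i ^ (2 * T) + (K : ℝ) * ((levelGap K + 1) * x) := by
      calc ∑ i ∈ Finset.range K, y i ^ T₂ ≤ ∑ i ∈ Finset.range K, (y i ^ (2 * T) + (levelGap K + 1) * x) := Finset.sum_le_sum hterm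
        _ = ∑ i ∈ Finset.range K, y i ^ (2 * T) + (K : ℝ) * ((levelGap K + 1) * x) := by
            rw [Finset.sum_add_distrib, Finset.sum_const, Finset.card_range, nsmul_eq_mul]
    have hGx : (K : ℝ) * ((levelGap K + 1) * x) ≤ δ := by
      have h1 : (K : ℝ) * ((levelGap K + 1) * x) = G * x := by rw [hGdef]; ring
      have h2 : G * x ≤ (G + 1) * (2 * lam) := mul_le_mul (by linarith only []) (by linarith only [hxl, hlam2]) hxpos.le (by positivity)
      have h3 : (G + 1) * (2 * lam) ≤ δ := by
        have h4 := hlamG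
        rw [le_div_iff₀ hG1] at h4; linarith only [h4]
      linarith only [h1, h2, h3]
    rw [hsplit]; linarith only [hhead, hGx, htailT₂', hhead2T]
  -- (4) LOWER: the dressed Ritz family gives the jaw `ρ y_j ≤ z_j` for `j ≤ K` (as in §2)
  have hritzle := KTDoorR3.ritzBasicsR3 L β (K + 1) φ hβ hφphys hφon hφdiag hφanti
  have hmnn : ∀ i, 0 ≤ qform su2Rep β (φ i) (φ i) := fun i => ritz_nonneg hβ (hφphys i)
  set m0 : ℝ := qform su2Rep β (φ 0) (φ 0) with hm0def
  have hm0nn : 0 ≤ m0 := hmnn 0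
  have e_eta : η * l / (L : ℝ) = η * x := by rw [hxdef]; ring
  have hcap' : levelValue su2Rep L β 0 ≤ Real.exp (η * x) * m0 := by
    refine levelValue_zero_le_of_forall_rayleigh_le su2Rep β (mul_nonneg (Real.exp_pos _).le hm0nn) fun ψ hψ _ => ?_
    have h1 := hcap ψ hψ
    rw [e_eta] at h1
    exact h1
  have hcap'' : Real.exp (-(η * x)) * levelValue su2Rep L β 0 ≤ m0 := by
    rw [Real.exp_neg, inv_mul_le_iff₀ (Real.exp_pos _)]; exact hcap'
  set ρ : ℝ := Real.exp (-((C1 * l + η) * x)) with hρdef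
  have hρpos : 0 < ρ := Real.exp_pos _
  have hClη : 0 ≤ (C1 * l + η) * x := by positivity
  have hρ1 : ρ ≤ 1 := by
    rw [hρdef]; exact Real.exp_le_one_iff.mpr (by linarith only [hClη])
  have e_lx : C * l ^ 2 / (L : ℝ) = C * (l * x) := by rw [hxdef]; ring
  have hexpC : Real.exp (C * l ^ 2 / L) ≤ Real.exp (C1 * (l * x)) := by
    rw [e_lx]; exact Real.exp_le_exp.mpr (mul_le_mul_of_nonneg_right hCC1 hlx.le)
  have hlow : ∀ j : ℕ, j ≤ K → ρ * y j ≤ z j := by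
    intro j hj
    have hjlt : j < K + 1 := Nat.lt_succ_of_le hj
    obtain ⟨-, hb⟩ := hratio ⟨j, hjlt⟩
    have hmj : qform su2Rep β (φ ⟨j, hjlt⟩) (φ ⟨j, hjlt⟩) ≤ levelValue su2Rep L β j := hritzle ⟨j, hjlt⟩
    have hb' : levelValue su2Rep 1 B j * m0 ≤
        Real.exp (C * l ^ 2 / L) * (qform su2Rep β (φ ⟨j, hjlt⟩) (φ ⟨j, hjlt⟩) * levelValue su2Rep 1 B 0) := hb
    have h1 : levelValue su2Rep 1 B j * m0 ≤ Real.exp (C1 * (l * x)) * (levelValue su2Rep L β j * levelValue su2Rep 1 B 0) :=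
      calc levelValue su2Rep 1 B j * m0
          ≤ Real.exp (C * l ^ 2 / L) * (qform su2Rep β (φ ⟨j, hjlt⟩) (φ ⟨j, hjlt⟩) * levelValue su2Rep 1 B 0) := hb'
        _ ≤ Real.exp (C1 * (l * x)) * (qform su2Rep β (φ ⟨j, hjlt⟩) (φ ⟨j, hjlt⟩) * levelValue su2Rep 1 B 0) :=
            mul_le_mul_of_nonneg_right hexpC (mul_nonneg (hmnn _) hmu0.le)
        _ ≤ Real.exp (C1 * (l * x)) * (levelValue su2Rep L β j * levelValue su2Rep 1 B 0) :=
            mul_le_mul_of_nonneg_left (mul_le_mul_of_nonneg_right hmj hmu0.le) (Real.exp_pos _).le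
    have key : ρ * levelValue su2Rep 1 B j * levelValue su2Rep L β 0 ≤ levelValue su2Rep L β j * levelValue su2Rep 1 B 0 := by
      have eρ : ρ = Real.exp (-(C1 * (l * x))) * Real.exp (-(η * x)) := by
        rw [hρdef, ← Real.exp_add]; congr 1; ring
      calc ρ * levelValue su2Rep 1 B j * levelValue su2Rep L β 0
          = Real.exp (-(C1 * (l * x))) * (levelValue su2Rep 1 B j * (Real.exp (-(η * x)) * levelValue su2Rep L β 0)) := by
            rw [eρ]; ring
        _ ≤ Real.exp (-(C1 * (l * x))) * (levelValue su2Rep 1 B j * m0) :=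
            mul_le_mul_of_nonneg_left (mul_le_mul_of_nonneg_left hcap'' (hmunn j)) (Real.exp_pos _).le
        _ ≤ Real.exp (-(C1 * (l * x))) * (Real.exp (C1 * (l * x)) * (levelValue su2Rep L β j * levelValue su2Rep 1 B 0)) :=
            mul_le_mul_of_nonneg_left h1 (Real.exp_pos _).le
        _ = levelValue su2Rep L β j * levelValue su2Rep 1 B 0 := by
            rw [← mul_assoc, ← Real.exp_add, neg_add_cancel, Real.exp_zero, one_mul]
    show ρ * (levelValue su2Rep 1 B j / levelValue su2Rep 1 B 0) ≤ levelValue su2Rep L β j / levelValue su2Rep L β 0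
    rw [← mul_div_assoc, div_le_div_iff₀ hmu0 hl0]
    exact key
  have hCl : C1 * l ≤ η := by
    have h3 : 2 * C1 / (2 * C1 + 1) ≤ 1 := by rw [div_le_one h2C1]; linarith only [hC10]
    calc C1 * l ≤ C1 * (2 * (η / (2 * C1 + 1))) := mul_le_mul_of_nonneg_left (by linarith only [hlam2, hlamη]) hC10
      _ = η * (2 * C1 / (2 * C1 + 1)) := by ring
      _ ≤ η * 1 := mul_le_mul_of_nonneg_left h3 hη.le
      _ = η := mul_one η
  have h2η : C1 * l + η ≤ 2 * η := by linarith only [hCl]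
  -- the lower jaw at any admissible time `T'`
  have hjaw : ∀ T' : ℕ, Summable (fun j => z j ^ T') → Summable (fun i => y i ^ T') → ∑' i, y (i + K) ^ T' ≤ δ →
      (T' : ℝ) * x ≤ 2 * (s + 1) → ∑' i, y i ^ T' - 2 * δ ≤ ∑' j, z j ^ T' := by
    intro T' hsz hsy htl hτ'
    have hfin : ∑ j ∈ Finset.range K, z j ^ T' ≤ ∑' j, z j ^ T' :=
      hsz.sum_le_tsum (Finset.range K) (fun j _ => pow_nonneg (hz0 j) T')
    have hheadlow : ρ ^ T' * ∑ j ∈ Finset.range K, y j ^ T' ≤ ∑ j ∈ Finset.range K, z j ^ T' := by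
      rw [Finset.mul_sum]
      apply Finset.sum_le_sum
      intro j hj
      have hjK : j ≤ K := (Finset.mem_range.mp hj).le
      have := pow_le_pow_left₀ (mul_nonneg hρpos.le (hy0 j)) (hlow j hjK) T'
      rwa [mul_pow] at this
    have hsplit : ∑' i, y i ^ T' = ∑ i ∈ Finset.range K, y i ^ T' + ∑' i, y (i + K) ^ T' := (hsy.sum_add_tsum_nat_add K).symm
    have hS0 : 0 ≤ ∑ i ∈ Finset.range K, y i ^ T' := Finset.sum_nonneg fun i _ => pow_nonneg (hy0 i) T'
    have hSK : ∑ i ∈ Finset.range K, y i ^ T' ≤ K := by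
      calc ∑ i ∈ Finset.range K, y i ^ T' ≤ ∑ i ∈ Finset.range K, (1 : ℝ) := Finset.sum_le_sum fun i _ => pow_le_one₀ (hy0 i) (hy1 i)
        _ = K := by simp
    have hρT : 1 - ρ ^ T' ≤ (C1 * l + η) * ((T' : ℝ) * x) := by
      have e : ρ ^ T' = Real.exp (-((C1 * l + η) * ((T' : ℝ) * x))) := by
        rw [hρdef, ← Real.exp_nat_mul]; congr 1; ring
      rw [e]; exact one_sub_exp_neg_le _
    have hsmall : (1 - ρ ^ T') * ∑ i ∈ Finset.range K, y i ^ T' ≤ δ := by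
      have h1 : (1 - ρ ^ T') * ∑ i ∈ Finset.range K, y i ^ T' ≤ ((C1 * l + η) * ((T' : ℝ) * x)) * K :=
        mul_le_mul hρT hSK hS0 (by positivity)
      have h2 : (C1 * l + η) * ((T' : ℝ) * x) ≤ (2 * η) * (2 * (s + 1)) := mul_le_mul h2η hτ' (by positivity) (by positivity)
      have h3 : ((C1 * l + η) * ((T' : ℝ) * x)) * K ≤ ((2 * η) * (2 * (s + 1))) * K := mul_le_mul_of_nonneg_right h2 (Nat.cast_nonneg K)
      have hK0 : (0 : ℝ) ≤ K := Nat.cast_nonneg K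
      have h4 : ((2 * η) * (2 * (s + 1))) * K ≤ η * (4 * ((K : ℝ) + 1) * (s + 1)) := by nlinarith only [hη.le, hs.le, hK0]
      linarith only [h1, h3, h4, hηden]
    have e1 : ρ ^ T' * ∑ i ∈ Finset.range K, y i ^ T' =
        ∑ i ∈ Finset.range K, y i ^ T' - (1 - ρ ^ T') * ∑ i ∈ Finset.range K, y i ^ T' := by ring
    rw [hsplit]
    linarith only [hheadlow, hfin, hsmall, htl, e1]
  have hL1 : a₁ - 2 * δ ≤ a := by rw [hadef, ha₁def]; exact hjaw T hsumzT hsumyT htailT' hτ1'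
  have hL2 : b₁ - 2 * δ ≤ b := by rw [hbdef, hb₁def]; exact hjaw (2 * T) hsumz2T hsumy2T htail2T' h2τ
  -- (5) sizes: `a, a₁ ≥ 1`, `0 ≤ b₁ ≤ a₁`
  have ha1 : 1 ≤ a := by
    have h := le_hasSum hHS 0 (fun j _ => pow_nonneg (hz0 j) T)
    have e : xval L β 0 ^ T = 1 := by show z 0 ^ T = 1; rw [hz0one, one_pow]
    rw [e] at h
    rw [hadef, hHS.tsum_eq]; exact h
  have ha₁1 : 1 ≤ a₁ := by
    have h := le_hasSum hHS1 0 (fun j _ => pow_nonneg (hy0 j) T)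
    have e : xval 1 B 0 ^ T = 1 := by show y 0 ^ T = 1; rw [hy0one, one_pow]
    rw [e] at h
    rw [ha₁def, hHS1.tsum_eq]; exact h
  have hb₁0 : 0 ≤ b₁ := by rw [hb₁def]; exact tsum_nonneg fun i => pow_nonneg (hy0 i) _
  have hb₁a₁ : b₁ ≤ a₁ := by
    rw [hb₁def, ha₁def]
    exact hsumy2T.tsum_le_tsum (fun i => pow_le_pow_of_le_one (hy0 i) (hy1 i) (by omega)) hsumyT
  -- (6) the ratio rule
  have hab : |a - a₁| ≤ 2 * δ := abs_sub_le_iff.2 ⟨by linarith only [hU1c, hδ], by linarith only [hL1]⟩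
  have hbb : |b - b₁| ≤ 3 * δ := abs_sub_le_iff.2 ⟨by linarith only [hA, hU2c, hRob], by linarith only [hL2, hδ]⟩
  have hkey : |b / a ^ 2 - b₁ / a₁ ^ 2| ≤ ε := by
    have h := ratio_rule (b := b) (b₁ := b₁) ha1 ha₁1 hb₁0 hb₁a₁
    have e : ε = 8 * δ := by rw [hδdef]; ring
    rw [e]; linarith only [h, hab, hbb, hδ]
  -- (7) back to traces: `r_L = b/a²`, `r_1 = b₁/a₁²`
  have hl0T : 0 < levelValue su2Rep L β 0 ^ T := pow_pos hl0 T
  have hmu0T : 0 < levelValue su2Rep 1 B 0 ^ T := pow_pos hmu0 T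
  have ea : a = physTrace L β T / levelValue su2Rep L β 0 ^ T := by rw [hadef]; exact hHS.tsum_eq
  have eb : b = physTrace L β (2 * T) / (levelValue su2Rep L β 0 ^ T) ^ 2 := by
    rw [hbdef, hHS2.tsum_eq, ← pow_mul, mul_comm T 2]
  have ea₁ : a₁ = physTrace 1 B T / levelValue su2Rep 1 B 0 ^ T := by rw [ha₁def]; exact hHS1.tsum_eq
  have eb₁ : b₁ = physTrace 1 B (2 * T) / (levelValue su2Rep 1 B 0 ^ T) ^ 2 := by
    rw [hb₁def, hHS12.tsum_eq, ← pow_mul, mul_comm T 2]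
  have er : physTrace L β (2 * T) / physTrace L β T ^ 2 = b / a ^ 2 := by
    rw [ea, eb, div_pow, div_div_div_cancel_right₀ (pow_ne_zero 2 hl0T.ne')]
  have er₁ : physTrace 1 B (2 * T) / physTrace 1 B T ^ 2 = b₁ / a₁ ^ 2 := by
    rw [ea₁, eb₁, div_pow, div_div_div_cancel_right₀ (pow_ne_zero 2 hmu0T.ne')]
  rw [er, er₁]
  exact hkey

/-- The converse door with the CLOSED child `OneSiteTail` (stmt-QuantumFields-20204) discharged by name. -/
theorem twistedTraceScaling_of_upperTraceLaw' (hU : UpperTraceLaw) (hDR : DressedRitz) : TwistedTraceScaling :=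
  twistedTraceScaling_of_upperTraceLaw hU OST.oneSiteTail_proof hDR

/-- ★★ (GEN 8) **The two cuts coincide.**  Given the sibling child `DressedRitz` (stmt-QuantumFields-20205), the ONE-SIDED law `UpperTraceLaw` and the
route's TWO-SIDED child `TwistedTraceScaling` (stmt-QuantumFields-20203) are EQUIVALENT; the forward direction needs no hypothesis at all (§5). -/
theorem upperTraceLaw_iff_twistedTraceScaling (hDR : DressedRitz) : UpperTraceLaw ↔ TwistedTraceScaling :=
  ⟨fun hU => twistedTraceScaling_of_upperTraceLaw' hU hDR, upperTraceLaw_of_twistedTraceScaling'⟩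

/-- RED from the one-sided law, second proof (through the route's own door): `UTL → DressedRitz → TTS → RED` by the landed corollary
`TraceDoor.runningReduction_of_twistedTraceScaling_dressedRitz` — agrees with §3 `runningReduction_of_upperTraceLaw`. -/
theorem runningReduction_of_upperTraceLaw_viaTTS (hU : UpperTraceLaw) (hDR : DressedRitz) :
    Summit.QuantumFields.YangMills.Theses.LuscherReduction.RunningReduction :=
  TraceDoor.runningReduction_of_twistedTraceScaling_dressedRitz (twistedTraceScaling_of_upperTraceLaw' hU hDR) hDR

end Summit.QuantumFields.YangMills.Cruxes.RunningReduction.UTD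

end
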